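import Literature.Analysis.FluidPDE.SelfSimilarEulerL3Exclusion
import Literature.Analysis.FluidPDE.NewtonPotentialHolder
import HarnessLib

/-!
# Chae–Shvydkoy 2013, Theorem 3.2 for general `p`, first stage: the two-scale inequalities of an
# `L^p` self-similar Euler profile, the growth exponent `β_p = 2 − 9/p`, and Theorem 3.2 for
# `3 ≤ p < 9/2`

Analysis/FluidPDE proof file (theorems only; no definitions, no named facts, no `sorry`) in the
story of `SelfSimilarEulerLpExclusion.lean` (the NAMED FACT `chaeShvydkoy2013_Lp_exclusion` =
D. Chae, R. Shvydkoy, *On formation of a locally self-similar collapse in the incompressible Euler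
equations*, Arch. Ration. Mech. Anal. **209** (2013) 999–1017 = arXiv:1201.6009 [ChaeShvydkoy2013],
Theorem 3.2, all `3 ≤ p < ∞`) and of `SelfSimilarEulerL3Exclusion.lean` (its `p = 3` slice proved).
Here the printed proof of Theorem 3.2 (§3.2.1–§3.2.2) is followed for GENERAL `3 < p < ∞` up to its
first growth bound, which already settles every `p < 9/2`:

1. **Hölder tools.** For `U ∈ L^p`, `P ∈ L^{p/2}` the flux integrand `f = |U|³ + 2|P||U|` of the
   local energy identity is only in `L^{p/3}(ℝ³)` (`memLp_flux_of_memLp`); its integrals over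
   annuli and against the radial weight `|y|^{2α−4}` are estimated by Hölder
   (`setIntegral_le_rpow_mul_measureReal_rpow`, `setIntegral_flux_le_rpow`,
   `setIntegral_weight_mul_flux_le`, with `∫_{|y|≥l}|y|^{−t} = 3|B₁|l^{3−t}/(t−3)` from
   `NewtonPotentialHolder.lean`).
2. **Range `α > 3/2` (§3.2.2), bootstrap-ready form** —
   `IsSelfSimilarEulerProfile.ball_energy_le_localFlux`: with ONE radial cut-off at scale `L`,
   `(2α−3) ∫_{|y|<L/2} |U|² ≤ (K/L) ∫_{|y|≤L} f` (CS13 (3.9); both left terms of the identity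
   are nonnegative, so no inner scale `l₁` is needed).
3. **Range `α ≤ 3/p` (§3.2.1), bootstrap-ready form** —
   `IsSelfSimilarEulerProfile.ball_energy_le_weightedFlux`: the weighted two-scale inequality
   `(3−2α) ∫_{|y|<l} |U|² ≤ K l^{3−2α} ∫_{|y|≥l} |y|^{2α−4} f` = CS13 (3.2)
   ("`(1/L^{N−2α})∫_{|y|≤L}|v|² ≤ C∫_{L≤|y|}(|v|³+|q||v|)/|y|^{N+1−2α}`"). The test function is the
   one of `SelfSimilarEulerL3Exclusion.lean` (`Φ = Φ₁Φ₂`, inner profile `~(|y|²/(2l²))^{α−3/2}`,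
   outer cut-off at scale `l₂`; the cut-off packages are private there and are re-derived here
   verbatim); new is the sharp radial weight `|Φ₁'(|y|²)||y| ≲ l^{3−2α}|y|^{2α−4}` and the
   Hölder control of the two outer terms, `≲ l₂^{2α−6/p}‖U‖²_{L^p(|y|²≥l₂²/2)}` and
   `≲ l₂^{2α−1−9/p}‖f‖_{L^{p/3}(|y|²≥l₂²/2)}`, which vanish as `l₂ → ∞` exactly because `2α ≤ 6/p` —
   the role of the hypothesis `α ≤ N/p` (the `L^p`-scaling).
4. **The first growth bound** `∫_{|y|<L} |U|² ≤ C L^{2−9/p}` — CS13 (3.3), `β_p = N − 1 − 3N/p`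
   (`energyGrowth_first_of_le`, `energyGrowth_first_of_gt_three_halves`).
5. **Theorem 3.2 for `3 < p < 9/2`** (`β_p < 0`: "If `β_p < 0`, then the proof is finished by
   sending `L → ∞`"): `IsSelfSimilarEulerProfile.eq_zero_of_memLp_of_lt_nine_halves`, and
   `chaeShvydkoy2013_Lp_exclusion_of_lt_nine_halves` = the named fact's body with the extra
   hypothesis `p.toReal < 9/2` (at `p = 3` the tree's `chaeShvydkoy2013_L3_exclusion`). As at
   `p = 3`, the associated-pressure formula (2.3) is not used below `p = 9/2`.

Deliberately NOT here: `9/2 ≤ p < ∞`, where CS13 bootstrap the growth exponent through the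
pressure-growth Lemma 3.3 (localised Calderón–Zygmund bounds for `ℛᵢℛⱼ(UᵢUⱼ)`); items 2–3 are the
two inequalities that bootstrap consumes. Cor. 3.4 (`chaeShvydkoy2013_energy_growth`) and Thm. 4.1
(`chaeShvydkoy2013_vorticity_exclusion`) are untouched.

## Mathlib / tree search

Reused: `IsSelfSimilarEulerProfile.localEnergy_identity_radial`, `chaeShvydkoy2013_L3_exclusion`
(`SelfSimilarEulerL3Exclusion.lean`), `eq_zero_of_energyGrowth_of_three_halves_lt`
(`SelfSimilarEulerLpExclusion.lean`), `memLp_restrict_of_continuous_isBounded`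
(`SteadyNSCaccioppoliTools.lean`), `NewtonPotentialHolder.integral_compl_ball_norm_rpow_neg` /
`integrableOn_compl_ball_norm_rpow_neg` (`NewtonPotentialHolder.lean`),
`Calculus.exists_bound_deriv_smoothTransition` (`Calculus/SmoothCutoff.lean`); Mathlib
`integral_mul_le_Lp_mul_Lq_of_nonneg` (Hölder), `Real.HolderConjugate.conjExponent`,
`MemLp.norm_rpow_div`, `MemLp.mul'`, `integrable_norm_rpow_iff`, `MemLp.locallyIntegrable`,
`IntegrableOn.mul_continuousOn`, `HasDerivAt.rpow_const`, `Filter.EventuallyEq.deriv_eq`,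
`tendsto_setIntegral_of_antitone`, `Measure.addHaar_real_closedBall'`, `ge_of_tendsto`.
No new definitions, no instances, no notation.
-/

noncomputable section

open MeasureTheory Set Filter Topology Metric InnerProductSpace
open scoped RealInnerProductSpace ENNReal NNReal Laplacian

namespace Literature.Analysis.FluidPDE

/-! ## The cut-off profiles of `SelfSimilarEulerL3Exclusion.lean` (private there; re-derived) -/

/-! ## The outer cut-off `Φ_a(t) = smoothTransition (2 − 2t/a)` -/

/-- The outer cut-off profile `t ↦ σ(2 − 2t/a)` (`= 1` for `t ≤ a/2`, `= 0` for `t ≥ a`,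
nonincreasing) is smooth. [folklore] -/
private theorem outerCut_contDiff (a : ℝ) {n : ℕ∞} :
    ContDiff ℝ n fun t : ℝ => Real.smoothTransition (2 - 2 / a * t) :=
  Real.smoothTransition.contDiff.comp ((contDiff_const).sub (contDiff_const.mul contDiff_id))

/-- Auxiliary computation. [folklore] -/
private theorem outerCut_eq_one {a t : ℝ} (ha : 0 < a) (ht : t ≤ a / 2) :
    Real.smoothTransition (2 - 2 / a * t) = 1 := by
  apply Real.smoothTransition.one_of_one_le
  have : 2 / a * t ≤ 2 / a * (a / 2) := by gcongr
  have h2 : 2 / a * (a / 2) = 1 := by field_simp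
  linarith

/-- Auxiliary computation. [folklore] -/
private theorem outerCut_eq_zero {a t : ℝ} (ha : 0 < a) (ht : a ≤ t) :
    Real.smoothTransition (2 - 2 / a * t) = 0 := by
  apply Real.smoothTransition.zero_of_nonpos
  have : 2 / a * a ≤ 2 / a * t := by gcongr
  have h2 : 2 / a * a = 2 := by field_simp
  linarith

/-- Auxiliary computation. [folklore] -/
private theorem outerCut_nonneg (a t : ℝ) : 0 ≤ Real.smoothTransition (2 - 2 / a * t) :=
  Real.smoothTransition.nonneg _

/-- Auxiliary computation. [folklore] -/
private theorem outerCut_le_one (a t : ℝ) : Real.smoothTransition (2 - 2 / a * t) ≤ 1 :=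
  Real.smoothTransition.le_one _

/-- Auxiliary computation. [folklore] -/
private theorem outerCut_hasDerivAt (a t : ℝ) :
    HasDerivAt (fun t : ℝ => Real.smoothTransition (2 - 2 / a * t))
      (deriv Real.smoothTransition (2 - 2 / a * t) * (-(2 / a))) t := by
  have h1 : HasDerivAt (fun t : ℝ => 2 - 2 / a * t) (-(2 / a)) t := by
    simpa using ((hasDerivAt_id t).const_mul (2 / a)).const_sub 2
  exact (Calculus.differentiable_smoothTransition _).hasDerivAt.comp t h1

/-- Auxiliary computation. [folklore] -/
private theorem outerCut_deriv (a t : ℝ) :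
    deriv (fun t : ℝ => Real.smoothTransition (2 - 2 / a * t)) t =
      deriv Real.smoothTransition (2 - 2 / a * t) * (-(2 / a)) :=
  (outerCut_hasDerivAt a t).deriv

/-- Auxiliary computation. [folklore] -/
private theorem outerCut_deriv_nonpos {a : ℝ} (ha : 0 < a) (t : ℝ) :
    deriv (fun t : ℝ => Real.smoothTransition (2 - 2 / a * t)) t ≤ 0 := by
  rw [outerCut_deriv]
  have h1 : 0 ≤ deriv Real.smoothTransition (2 - 2 / a * t) :=
    Real.smoothTransition.monotone.deriv_nonneg
  have h2 : 0 < 2 / a := by positivity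
  nlinarith

/-- Auxiliary computation. [folklore] -/
private theorem outerCut_deriv_eq_zero_of_le {a t : ℝ} (ha : 0 < a) (ht : a ≤ t) :
    deriv (fun t : ℝ => Real.smoothTransition (2 - 2 / a * t)) t = 0 := by
  rw [outerCut_deriv, Calculus.deriv_smoothTransition_of_nonpos, zero_mul]
  have : 2 / a * a ≤ 2 / a * t := by gcongr
  have h2 : 2 / a * a = 2 := by field_simp
  linarith

/-- Auxiliary computation. [folklore] -/
private theorem outerCut_deriv_eq_zero_of_le_half {a t : ℝ} (ha : 0 < a) (ht : t ≤ a / 2) :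
    deriv (fun t : ℝ => Real.smoothTransition (2 - 2 / a * t)) t = 0 := by
  rw [outerCut_deriv, Calculus.deriv_smoothTransition_of_one_le, zero_mul]
  have : 2 / a * t ≤ 2 / a * (a / 2) := by gcongr
  have h2 : 2 / a * (a / 2) = 1 := by field_simp
  linarith

/-- `|Φ_a'(t)| ≤ 2D/a` where `D` bounds `|smoothTransition'|`. [folklore] -/
private theorem abs_outerCut_deriv_le {a : ℝ} (ha : 0 < a) {D : ℝ}
    (hD : ∀ s, |deriv Real.smoothTransition s| ≤ D) (t : ℝ) :
    |deriv (fun t : ℝ => Real.smoothTransition (2 - 2 / a * t)) t| ≤ 2 * D / a := by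
  rw [outerCut_deriv, abs_mul, abs_neg, abs_of_pos (by positivity : (0 : ℝ) < 2 / a)]
  calc |deriv Real.smoothTransition (2 - 2 / a * t)| * (2 / a) ≤ D * (2 / a) := by
        gcongr
        exact hD _
    _ = 2 * D / a := by ring

/-! ## The inner profile `ψ_β(s) = 1 + smoothTransition (s − 1) · ((s/2)^{−β} − 1)` (range `α ≤ 1`)

`ψ_β = 1` on `s ≤ 1`, `ψ_β(s) = (s/2)^{−β}` for `s ≥ 2`, and `s^β ψ_β(s)` is nondecreasing:
`β ψ_β(s) + s ψ_β'(s) ≥ 0`. With `β = 3/2 − α > 0` and `Φ₁(t) = ψ_β(t/l₁²)` this is Chae–Shvydkoy's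
integrated family of cut-offs `∫ l^{2α−4} σ(y/l) dl` (§3.2.1) collapsed into one test function. -/

/-- `ψ_β = 1` on `s ≤ 1`. [folklore] -/
private theorem inner_eq_one {β s : ℝ} (hs : s ≤ 1) :
    1 + Real.smoothTransition (s - 1) * ((s / 2) ^ (-β) - 1) = 1 := by
  rw [Real.smoothTransition.zero_of_nonpos (by linarith), zero_mul, add_zero]

/-- Auxiliary computation. [folklore] -/
private theorem inner_eq_rpow {β s : ℝ} (hs : 2 ≤ s) :
    1 + Real.smoothTransition (s - 1) * ((s / 2) ^ (-β) - 1) = (s / 2) ^ (-β) := by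
  rw [Real.smoothTransition.one_of_one_le (by linarith), one_mul, add_sub_cancel]

/-- `ψ_β = (1 − T) + T g` with `T ∈ [0,1]`, `g > 0`: hence `ψ_β ≥ 0` (for `s > 0`). [folklore] -/
private theorem inner_nonneg {β s : ℝ} (hs : 0 < s) :
    0 ≤ 1 + Real.smoothTransition (s - 1) * ((s / 2) ^ (-β) - 1) := by
  have hT0 := Real.smoothTransition.nonneg (s - 1)
  have hT1 := Real.smoothTransition.le_one (s - 1)
  have hg : 0 < (s / 2) ^ (-β) := Real.rpow_pos_of_pos (by positivity) _
  have h1 : 0 ≤ Real.smoothTransition (s - 1) * (s / 2) ^ (-β) := mul_nonneg hT0 hg.le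
  nlinarith

/-- For `s ≥ 2` (and `β ≥ 0`), `ψ_β(s) = (s/2)^{−β} ≤ 1`. [folklore] -/
private theorem inner_le_one {β s : ℝ} (hβ : 0 ≤ β) (hs : 2 ≤ s) :
    1 + Real.smoothTransition (s - 1) * ((s / 2) ^ (-β) - 1) ≤ 1 := by
  rw [inner_eq_rpow hs]
  exact Real.rpow_le_one_of_one_le_of_nonpos (by linarith) (by linarith)

/-- The derivative of `ψ_β` at `s > 0`. [folklore] -/
private theorem inner_hasDerivAt {β s : ℝ} (hs : 0 < s) :
    HasDerivAt (fun s : ℝ => 1 + Real.smoothTransition (s - 1) * ((s / 2) ^ (-β) - 1))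
      (deriv Real.smoothTransition (s - 1) * ((s / 2) ^ (-β) - 1) +
        Real.smoothTransition (s - 1) * (1 / 2 * (-β) * (s / 2) ^ (-β - 1))) s := by
  have hT : HasDerivAt (fun s : ℝ => Real.smoothTransition (s - 1))
      (deriv Real.smoothTransition (s - 1)) s := by
    have h2 := (Calculus.differentiable_smoothTransition (s - 1)).hasDerivAt.comp s
      ((hasDerivAt_id s).sub_const 1)
    simpa [Function.comp_def] using h2
  have hg : HasDerivAt (fun s : ℝ => (s / 2) ^ (-β)) (1 / 2 * (-β) * (s / 2) ^ (-β - 1)) s := by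
    have h1 : HasDerivAt (fun s : ℝ => s / 2) (1 / 2) s := by
      simpa using (hasDerivAt_id s).div_const 2
    exact h1.rpow_const (Or.inl (by positivity))
  simpa using (hT.mul (hg.sub_const 1)).const_add 1

/-- The derivative of `ψ_β` vanishes on `s < 1` (there `ψ_β ≡ 1`). [folklore] -/
private theorem inner_hasDerivAt_zero {β s : ℝ} (hs : s < 1) :
    HasDerivAt (fun s : ℝ => 1 + Real.smoothTransition (s - 1) * ((s / 2) ^ (-β) - 1)) 0 s := by
  have hev : (fun s : ℝ => 1 + Real.smoothTransition (s - 1) * ((s / 2) ^ (-β) - 1)) =ᶠ[𝓝 s]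
      fun _ => (1 : ℝ) := by
    filter_upwards [Iio_mem_nhds hs] with r hr using inner_eq_one hr.le
  exact (hasDerivAt_const s (1 : ℝ)).congr_of_eventuallyEq hev

/-- The derivative of `ψ_β`, as a closed formula valid at every point (the formula vanishes
identically on `s ≤ 1`). [folklore] -/
private theorem inner_deriv (β s : ℝ) :
    deriv (fun s : ℝ => 1 + Real.smoothTransition (s - 1) * ((s / 2) ^ (-β) - 1)) s =
      deriv Real.smoothTransition (s - 1) * ((s / 2) ^ (-β) - 1) +
        Real.smoothTransition (s - 1) * (1 / 2 * (-β) * (s / 2) ^ (-β - 1)) := by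
  by_cases hs : 0 < s
  · exact (inner_hasDerivAt hs).deriv
  · push Not at hs
    rw [(inner_hasDerivAt_zero (by linarith : s < 1)).deriv,
      Calculus.deriv_smoothTransition_of_nonpos (by linarith),
      Real.smoothTransition.zero_of_nonpos (by linarith)]
    ring

/-- Auxiliary computation. [folklore] -/
private theorem inner_deriv_eq_zero {β s : ℝ} (hs : s ≤ 1) :
    deriv (fun s : ℝ => 1 + Real.smoothTransition (s - 1) * ((s / 2) ^ (-β) - 1)) s = 0 := by
  rw [inner_deriv, Calculus.deriv_smoothTransition_of_nonpos (by linarith),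
    Real.smoothTransition.zero_of_nonpos (by linarith)]
  ring

/-- Auxiliary computation. [folklore] -/
private theorem inner_contDiff (β : ℝ) :
    ContDiff ℝ 1 fun s : ℝ => 1 + Real.smoothTransition (s - 1) * ((s / 2) ^ (-β) - 1) := by
  refine contDiff_iff_contDiffAt.2 fun s => ?_
  by_cases hs : s < 1
  · have hev : (fun s : ℝ => 1 + Real.smoothTransition (s - 1) * ((s / 2) ^ (-β) - 1)) =ᶠ[𝓝 s]
        fun _ => (1 : ℝ) := by
      filter_upwards [Iio_mem_nhds hs] with r hr using inner_eq_one hr.le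
    exact contDiffAt_const.congr_of_eventuallyEq hev
  · push Not at hs
    have hT : ContDiffAt ℝ 1 (fun s : ℝ => Real.smoothTransition (s - 1)) s :=
      Real.smoothTransition.contDiffAt.comp s (contDiffAt_id.sub contDiffAt_const)
    have hg : ContDiffAt ℝ 1 (fun s : ℝ => (s / 2) ^ (-β)) s :=
      (contDiffAt_id.div_const 2).rpow_const_of_ne (by positivity)
    exact contDiffAt_const.add (hT.mul (hg.sub contDiffAt_const))

/-- **Monotonicity of `s^β ψ_β`**: `β ψ_β(s) + s ψ_β'(s) ≥ 0` (`β ≥ 0`). [folklore] -/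
private theorem inner_sign {β : ℝ} (hβ : 0 ≤ β) (s : ℝ) :
    0 ≤ β * (1 + Real.smoothTransition (s - 1) * ((s / 2) ^ (-β) - 1)) +
      s * deriv (fun s : ℝ => 1 + Real.smoothTransition (s - 1) * ((s / 2) ^ (-β) - 1)) s := by
  by_cases hs : s ≤ 1
  · rw [inner_eq_one hs, inner_deriv_eq_zero hs]
    nlinarith
  · push Not at hs
    have hs0 : 0 < s := by linarith
    rw [inner_deriv]
    set T := Real.smoothTransition (s - 1) with hT_def
    set T' := deriv Real.smoothTransition (s - 1) with hT'_def
    set g := (s / 2) ^ (-β) with hg_def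
    have hsg : s * (1 / 2 * (-β) * (s / 2) ^ (-β - 1)) = -β * g := by
      have hne : (s / 2 : ℝ) ≠ 0 := by positivity
      have : (s / 2) ^ (-β) = (s / 2) ^ (-β - 1) * (s / 2) := by
        rw [← Real.rpow_add_one hne]
        ring_nf
      rw [hg_def, this]
      ring
    have hT1 : T ≤ 1 := Real.smoothTransition.le_one _
    have hT'0 : 0 ≤ T' := Real.smoothTransition.monotone.deriv_nonneg
    -- the identity `βψ + sψ' = β(1 − T) + s T'(g − 1)`
    have hid : β * (1 + T * (g - 1)) + s * (T' * (g - 1) + T * (1 / 2 * (-β) * (s / 2) ^ (-β - 1))) =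
        β * (1 - T) + s * T' * (g - 1) := by
      have : s * (T * (1 / 2 * (-β) * (s / 2) ^ (-β - 1))) = T * (-β * g) := by
        rw [← hsg]
        ring
      linear_combination this
    rw [hid]
    have h1 : 0 ≤ β * (1 - T) := mul_nonneg hβ (by linarith)
    have h2 : 0 ≤ s * T' * (g - 1) := by
      by_cases hs2 : s ≤ 2
      · have hg1 : 1 ≤ g :=
          Real.one_le_rpow_of_pos_of_le_one_of_nonpos (by positivity) (by linarith) (by linarith)
        have : 0 ≤ s * T' := mul_nonneg hs0.le hT'0
        nlinarith
      · push Not at hs2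
        rw [hT'_def, Calculus.deriv_smoothTransition_of_one_le (by linarith)]
        simp
    linarith

/-- **Decay of `ψ_β'`**: `s |ψ_β'(s)| ≤ (D + β) 2^{β+1}` for `s ≥ 1`, where `|σ'| ≤ D`. [folklore] -/
private theorem inner_abs_deriv_mul_le {β : ℝ} (hβ : 0 ≤ β) {D : ℝ} (hD0 : 0 ≤ D)
    (hD : ∀ r, |deriv Real.smoothTransition r| ≤ D) {s : ℝ} (hs : 1 ≤ s) :
    |deriv (fun s : ℝ => 1 + Real.smoothTransition (s - 1) * ((s / 2) ^ (-β) - 1)) s| * s ≤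
      (D + β) * (2 : ℝ) ^ (β + 1) := by
  have hs0 : 0 < s := by linarith
  rw [inner_deriv]
  set T := Real.smoothTransition (s - 1) with hT_def
  set T' := deriv Real.smoothTransition (s - 1) with hT'_def
  set g := (s / 2) ^ (-β) with hg_def
  have hne : (s / 2 : ℝ) ≠ 0 := by positivity
  have h2β : (2 : ℝ) ^ (β + 1) = 2 ^ β * 2 := Real.rpow_add_one two_ne_zero β
  have h2β0 : 0 < (2 : ℝ) ^ β := Real.rpow_pos_of_pos two_pos _
  have hg0 : 0 < g := Real.rpow_pos_of_pos (by positivity) _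
  -- `g ≤ 2^β` (as `s/2 ≥ 1/2`)
  have hgle : g ≤ (2 : ℝ) ^ β := by
    have h1 : g ≤ (1 / 2 : ℝ) ^ (-β) :=
      Real.rpow_le_rpow_of_nonpos (by norm_num) (by linarith) (by linarith)
    have h2 : (1 / 2 : ℝ) ^ (-β) = 2 ^ β := by
      rw [one_div, Real.inv_rpow (by norm_num), Real.rpow_neg (by norm_num), inv_inv]
    linarith [h2 ▸ h1]
  -- second term: `s · |T| · (β/2) (s/2)^{−β−1} = β T g ≤ β 2^β`
  have hsg : s * (1 / 2 * (-β) * (s / 2) ^ (-β - 1)) = -β * g := by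
    have : (s / 2) ^ (-β) = (s / 2) ^ (-β - 1) * (s / 2) := by
      rw [← Real.rpow_add_one hne]
      ring_nf
    rw [hg_def, this]
    ring
  have hT0 : 0 ≤ T := Real.smoothTransition.nonneg _
  have hT1 : T ≤ 1 := Real.smoothTransition.le_one _
  have hT'0 : 0 ≤ T' := Real.smoothTransition.monotone.deriv_nonneg
  have hB : |T * (1 / 2 * (-β) * (s / 2) ^ (-β - 1))| * s ≤ β * 2 ^ β := by
    have : |T * (1 / 2 * (-β) * (s / 2) ^ (-β - 1))| * s = β * T * g := by
      rw [abs_mul, abs_of_nonneg hT0]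
      have hin : 1 / 2 * (-β) * (s / 2) ^ (-β - 1) ≤ 0 := by
        have : 0 < (s / 2) ^ (-β - 1) := Real.rpow_pos_of_pos (by positivity) _
        nlinarith
      rw [abs_of_nonpos hin]
      linear_combination (-T) * hsg
    rw [this]
    have : T * g ≤ 1 * 2 ^ β := by gcongr
    nlinarith
  -- first term: `s |T'| |g − 1| ≤ D 2^{β+1}` (vanishes for `s > 2`)
  have hA : |T' * (g - 1)| * s ≤ D * (2 ^ β * 2) := by
    by_cases hs2 : s ≤ 2
    · have hg1 : 1 ≤ g :=
        Real.one_le_rpow_of_pos_of_le_one_of_nonpos (by positivity) (by linarith) (by linarith)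
      rw [abs_mul, abs_of_nonneg (by linarith : 0 ≤ g - 1)]
      calc |T'| * (g - 1) * s ≤ D * 2 ^ β * 2 := by
            gcongr
            · exact hD _
            · linarith
        _ = D * (2 ^ β * 2) := by ring
    · push Not at hs2
      rw [hT'_def, Calculus.deriv_smoothTransition_of_one_le (by linarith), zero_mul, abs_zero,
        zero_mul]
      positivity
  calc |T' * (g - 1) + T * (1 / 2 * (-β) * (s / 2) ^ (-β - 1))| * s
      ≤ (|T' * (g - 1)| + |T * (1 / 2 * (-β) * (s / 2) ^ (-β - 1))|) * s := by
        gcongr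
        exact abs_add_le _ _
    _ = |T' * (g - 1)| * s + |T * (1 / 2 * (-β) * (s / 2) ^ (-β - 1))| * s := by ring
    _ ≤ D * (2 ^ β * 2) + β * 2 ^ β := add_le_add hA hB
    _ ≤ (D + β) * (2 : ℝ) ^ (β + 1) := by
        rw [h2β]
        nlinarith

/-! ## Theorem 3.2 at `p = 3` in the range `−1 < α ≤ 1` -/

/-- **The inner cut-off, packaged.** For `β ≥ 0`, `a > 0` and `|σ'| ≤ D`: the `C¹` function
`Φ₁(t) = ψ_β(t/a)` is `1` on `t ≤ a`, equals `(t/(2a))^{−β} ≤ 1` on `t ≥ 2a`, is `≥ 0` on `t > 0`,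
`t ↦ t^β Φ₁(t)` is nondecreasing (`−2βΦ₁ − 2tΦ₁' ≤ 0`), and `t |Φ₁'(t)| ≤ (D+β)2^{β+1}` for
`t ≥ a`. [folklore] -/
private theorem exists_innerCut {β a D : ℝ} (hβ : 0 ≤ β) (ha : 0 < a) (hD0 : 0 ≤ D)
    (hD : ∀ r, |deriv Real.smoothTransition r| ≤ D) :
    ∃ Φ₁ : ℝ → ℝ, ContDiff ℝ 1 Φ₁ ∧ (∀ t, t ≤ a → Φ₁ t = 1) ∧ (∀ t, t ≤ a → deriv Φ₁ t = 0) ∧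
      (∀ t, 0 < t → 0 ≤ Φ₁ t) ∧ (∀ t, 2 * a ≤ t → Φ₁ t ≤ 1) ∧
      (∀ t, 2 * a ≤ t → Φ₁ t = (t / a / 2) ^ (-β)) ∧
      (∀ t, -(2 * β) * Φ₁ t - 2 * t * deriv Φ₁ t ≤ 0) ∧
      (∀ t, a ≤ t → |deriv Φ₁ t| * t ≤ (D + β) * (2 : ℝ) ^ (β + 1)) := by
  set ψ : ℝ → ℝ := fun s => 1 + Real.smoothTransition (s - 1) * ((s / 2) ^ (-β) - 1) with hψ
  have hψ1 : ContDiff ℝ 1 ψ := inner_contDiff β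
  have hd : ∀ t, HasDerivAt (fun t => ψ (t / a)) (deriv ψ (t / a) * (1 / a)) t := fun t =>
    ((hψ1.differentiable one_ne_zero) _).hasDerivAt.comp t
      (by simpa using (hasDerivAt_id t).div_const a)
  refine ⟨fun t => ψ (t / a), hψ1.comp (contDiff_id.div_const a), ?_, ?_, ?_, ?_, ?_, ?_, ?_⟩
  · intro t ht
    exact inner_eq_one (by rwa [div_le_one ha])
  · intro t ht
    rw [(hd t).deriv, show deriv ψ (t / a) = 0 from inner_deriv_eq_zero (by rwa [div_le_one ha]),
      zero_mul]
  · intro t ht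
    exact inner_nonneg (by positivity)
  · intro t ht
    exact inner_le_one hβ (by rw [le_div_iff₀ ha]; linarith)
  · intro t ht
    exact inner_eq_rpow (by rw [le_div_iff₀ ha]; linarith)
  · intro t
    rw [(hd t).deriv]
    have hs := inner_sign hβ (t / a)
    have : -(2 * β) * ψ (t / a) - 2 * t * (deriv ψ (t / a) * (1 / a)) =
        -2 * (β * ψ (t / a) + t / a * deriv ψ (t / a)) := by
      field_simp
      ring
    rw [this]
    linarith
  · intro t ht
    rw [(hd t).deriv, abs_mul, abs_of_pos (by positivity : (0 : ℝ) < 1 / a)]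
    have hbd := inner_abs_deriv_mul_le hβ hD0 hD (s := t / a) (by rwa [le_div_iff₀ ha, one_mul])
    calc |deriv ψ (t / a)| * (1 / a) * t = |deriv ψ (t / a)| * (t / a) := by
          field_simp
      _ ≤ (D + β) * (2 : ℝ) ^ (β + 1) := hbd

/-- **The outer cut-off, packaged.** For `b > 0` and `|σ'| ≤ D`: the smooth function
`Φ₂(t) = σ(2 − 2t/b)` is `1` on `t ≤ b/2`, `0` on `t ≥ b`, takes values in `[0,1]`, is
nonincreasing, and `|Φ₂'| ≤ 2D/b` (with `Φ₂' = 0` off `(b/2, b)`). [folklore] -/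
private theorem exists_outerCut {b D : ℝ} (hb : 0 < b)
    (hD : ∀ r, |deriv Real.smoothTransition r| ≤ D) :
    ∃ Φ₂ : ℝ → ℝ, ContDiff ℝ 1 Φ₂ ∧ (∀ t, t ≤ b / 2 → Φ₂ t = 1) ∧ (∀ t, b ≤ t → Φ₂ t = 0) ∧
      (∀ t, 0 ≤ Φ₂ t) ∧ (∀ t, Φ₂ t ≤ 1) ∧ (∀ t, deriv Φ₂ t ≤ 0) ∧
      (∀ t, |deriv Φ₂ t| ≤ 2 * D / b) ∧ (∀ t, t ≤ b / 2 → deriv Φ₂ t = 0) ∧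
      (∀ t, b ≤ t → deriv Φ₂ t = 0) :=
  ⟨fun t => Real.smoothTransition (2 - 2 / b * t), outerCut_contDiff b,
    fun _ ht => outerCut_eq_one hb ht, fun _ ht => outerCut_eq_zero hb ht, outerCut_nonneg b,
    outerCut_le_one b, outerCut_deriv_nonpos hb, abs_outerCut_deriv_le hb hD,
    fun _ ht => outerCut_deriv_eq_zero_of_le_half hb ht,
    fun _ ht => outerCut_deriv_eq_zero_of_le hb ht⟩

/-- **(P1) The left integrand, pointwise.** With `Φ = Φ₁Φ₂`:
`κ(t)|U|² ≤ −(3−2α) 1_{|y|<l₁} |U|² + 2tΦ₁(t)(−Φ₂'(t))|U|²`, `t = |y|²`. [folklore] -/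
private theorem twoScale_P1 {α a b l₁ : ℝ} {Φ₁ Φ₂ : ℝ → ℝ}
    (U : EuclideanSpace ℝ (Fin 3) → EuclideanSpace ℝ (Fin 3)) (ha : a = l₁ ^ 2) (hab : a ≤ b / 2)
    (hΦ₁one : ∀ t, t ≤ a → Φ₁ t = 1) (hΦ₁d0 : ∀ t, t ≤ a → deriv Φ₁ t = 0)
    (hΦ₁sign : ∀ t, (2 * α - 3) * Φ₁ t - 2 * t * deriv Φ₁ t ≤ 0)
    (hΦ₂one : ∀ t, t ≤ b / 2 → Φ₂ t = 1) (hΦ₂nn : ∀ t, 0 ≤ Φ₂ t)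
    (hΦd : ∀ t, deriv (fun t => Φ₁ t * Φ₂ t) t = deriv Φ₁ t * Φ₂ t + Φ₁ t * deriv Φ₂ t)
    (y : EuclideanSpace ℝ (Fin 3)) :
    ((2 * α - 3) * (Φ₁ (‖y‖ ^ 2) * Φ₂ (‖y‖ ^ 2)) -
        2 * ‖y‖ ^ 2 * deriv (fun t => Φ₁ t * Φ₂ t) (‖y‖ ^ 2)) * ‖U y‖ ^ 2 ≤
      -(3 - 2 * α) * (ball (0 : EuclideanSpace ℝ (Fin 3)) l₁).indicator (fun y => ‖U y‖ ^ 2) y +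
        2 * ‖y‖ ^ 2 * Φ₁ (‖y‖ ^ 2) * (-deriv Φ₂ (‖y‖ ^ 2)) * ‖U y‖ ^ 2 := by
  have hκ₁ := hΦ₁sign (‖y‖ ^ 2)
  have hdecomp : ((2 * α - 3) * (Φ₁ (‖y‖ ^ 2) * Φ₂ (‖y‖ ^ 2)) -
      2 * ‖y‖ ^ 2 * deriv (fun t => Φ₁ t * Φ₂ t) (‖y‖ ^ 2)) * ‖U y‖ ^ 2 =
      ((2 * α - 3) * Φ₁ (‖y‖ ^ 2) - 2 * ‖y‖ ^ 2 * deriv Φ₁ (‖y‖ ^ 2)) * Φ₂ (‖y‖ ^ 2) *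
        ‖U y‖ ^ 2 + 2 * ‖y‖ ^ 2 * Φ₁ (‖y‖ ^ 2) * (-deriv Φ₂ (‖y‖ ^ 2)) * ‖U y‖ ^ 2 := by
    rw [hΦd]
    ring
  rw [hdecomp]
  gcongr ?_ + _
  by_cases hy : y ∈ ball (0 : EuclideanSpace ℝ (Fin 3)) l₁
  · rw [indicator_of_mem hy]
    have hta : ‖y‖ ^ 2 ≤ a := by
      rw [mem_ball_zero_iff] at hy
      rw [ha]
      exact pow_le_pow_left₀ (norm_nonneg _) hy.le 2
    have htb : ‖y‖ ^ 2 ≤ b / 2 := by linarith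
    rw [hΦ₁one _ hta, hΦ₁d0 _ hta, hΦ₂one _ htb]
    nlinarith [sq_nonneg ‖U y‖]
  · rw [indicator_of_notMem hy, mul_zero]
    have : 0 ≤ -((2 * α - 3) * Φ₁ (‖y‖ ^ 2) - 2 * ‖y‖ ^ 2 * deriv Φ₁ (‖y‖ ^ 2)) *
        Φ₂ (‖y‖ ^ 2) := mul_nonneg (by linarith) (hΦ₂nn _)
    nlinarith [sq_nonneg ‖U y‖]

/-! ## Theorem 3.2 for general `3 < p < ∞` (CS13 §3.2): Hölder tools

For `p > 3` the flux integrand `f = |U|³ + 2|P||U|` of an `L^p` profile with `L^{p/2}` pressure is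
only in `L^{p/3}(ℝ³)`, and the cut-off terms of the local energy identity are estimated by Hölder's
inequality — against the volume of the annulus carrying `Φ'` (a factor `|B_l|^{1−3/p}`), or against
the radial weight `|y|^{2α−4}` of Chae–Shvydkoy's integrated cut-off family — producing the first
growth exponent `β_p = N − 1 − 3N/p = 2 − 9/p` of CS13 (3.3). -/

/-- Tails `∫_{r ≤ |y|²} g → 0` (`r → ∞`) of an integrable `g`. [folklore] -/
private theorem tendsto_tail_setIntegral_norm_sq_le {g : EuclideanSpace ℝ (Fin 3) → ℝ}
    (hg : Integrable g (volume : Measure (EuclideanSpace ℝ (Fin 3)))) :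
    Tendsto (fun r : ℝ => ∫ y in {y : EuclideanSpace ℝ (Fin 3) | r ≤ ‖y‖ ^ 2}, g y)
      atTop (𝓝 0) := by
  have hmeas : ∀ r : ℝ, MeasurableSet {y : EuclideanSpace ℝ (Fin 3) | r ≤ ‖y‖ ^ 2} := fun r =>
    (isClosed_le continuous_const (continuous_norm.pow 2)).measurableSet
  have hanti : Antitone fun r : ℝ => {y : EuclideanSpace ℝ (Fin 3) | r ≤ ‖y‖ ^ 2} :=
    fun r₁ r₂ h y (hy : r₂ ≤ ‖y‖ ^ 2) => le_trans h hy
  have h := tendsto_setIntegral_of_antitone (μ := volume) (f := g) hmeas hanti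
    ⟨0, hg.integrableOn⟩
  have hempty : (⋂ r : ℝ, {y : EuclideanSpace ℝ (Fin 3) | r ≤ ‖y‖ ^ 2}) = ∅ := by
    ext y
    simp only [mem_iInter, mem_setOf_eq, mem_empty_iff_false, iff_false, not_forall, not_le]
    exact ⟨‖y‖ ^ 2 + 1, by linarith⟩
  rwa [hempty, Measure.restrict_empty, integral_zero_measure] at h

/-- **Hölder against `1`, general exponent.** For `1 < r`, `φ ≥ 0` with `φ ∈ L^r(S)` and
`|S| < ∞`: `∫_S φ ≤ (∫_S φ^r)^{1/r} |S|^{1 − 1/r}`. [folklore] -/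
private theorem setIntegral_le_rpow_mul_measureReal_rpow {r : ℝ} (hr : 1 < r)
    {φ : EuclideanSpace ℝ (Fin 3) → ℝ} {S : Set (EuclideanSpace ℝ (Fin 3))}
    (hS : volume S ≠ ⊤) (hφ0 : ∀ y, 0 ≤ φ y)
    (hφ : MemLp φ (ENNReal.ofReal r) (volume.restrict S)) :
    ∫ y in S, φ y ≤ (∫ y in S, φ y ^ r) ^ (1 / r) * (volume.real S) ^ (1 - 1 / r) := by
  haveI : IsFiniteMeasure (volume.restrict S) := isFiniteMeasure_restrict.2 hS
  have hpq : Real.HolderConjugate r (Real.conjExponent r) := Real.HolderConjugate.conjExponent hr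
  have h := integral_mul_le_Lp_mul_Lq_of_nonneg (μ := volume.restrict S) hpq
    (f := φ) (g := fun _ => (1 : ℝ))
    (Eventually.of_forall hφ0) (Eventually.of_forall fun _ => zero_le_one) hφ (memLp_const 1)
  have hr0 : r ≠ 0 := by positivity
  have he : 1 / Real.conjExponent r = 1 - 1 / r := by
    have h1 := hpq.inv_add_inv_eq_inv
    rw [inv_one] at h1
    rw [one_div, one_div]
    linarith
  simp only [mul_one, Real.one_rpow, integral_const, smul_eq_mul,
    measureReal_restrict_apply_univ, he] at h
  exact h

/-- **Hölder against `1` for `|U|²`, exponent `p/2`.** For `p > 2`, `U` continuous and `S`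
bounded: `∫_S |U|² ≤ (∫_S |U|^p)^{2/p} |S|^{1 − 2/p}`. [folklore] -/
private theorem setIntegral_norm_sq_le_rpow_of_continuous {p : ℝ} (hp : 2 < p)
    {U : EuclideanSpace ℝ (Fin 3) → EuclideanSpace ℝ (Fin 3)} (hU : Continuous U)
    {S : Set (EuclideanSpace ℝ (Fin 3))} (hS : Bornology.IsBounded S) :
    ∫ y in S, ‖U y‖ ^ 2 ≤ (∫ y in S, ‖U y‖ ^ p) ^ (2 / p) * (volume.real S) ^ (1 - 2 / p) := by
  have hr : 1 < p / 2 := by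
    rw [lt_div_iff₀ two_pos]
    linarith
  have hφ : MemLp (fun y => ‖U y‖ ^ 2) (ENNReal.ofReal (p / 2)) (volume.restrict S) :=
    memLp_restrict_of_continuous_isBounded (hU.norm.pow 2) hS _
  have h := setIntegral_le_rpow_mul_measureReal_rpow hr hS.measure_lt_top.ne
    (fun y => sq_nonneg _) hφ
  have e : ∀ y : EuclideanSpace ℝ (Fin 3), (‖U y‖ ^ 2) ^ (p / 2) = ‖U y‖ ^ p := fun y => by
    rw [← Real.rpow_natCast, ← Real.rpow_mul (norm_nonneg _)]
    congr 1
    push_cast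
    ring
  have e1 : 1 / (p / 2) = 2 / p := by
    rw [one_div, inv_div]
  simp only [e, e1] at h
  exact h

/-- **`L^p` membership as integrability of `|·|^p`, real exponent.** [folklore] -/
private theorem integrable_norm_rpow_of_memLp_ofReal {α' : Type*} [MeasurableSpace α']
    {μ : Measure α'} {F : Type*} [NormedAddCommGroup F] {g : α' → F} {r : ℝ} (hr : 0 < r)
    (hg : MemLp g (ENNReal.ofReal r) μ) : Integrable (fun x => ‖g x‖ ^ r) μ := by
  have h := hg.integrable_norm_rpow (by simp [hr]) ENNReal.ofReal_ne_top
  rwa [ENNReal.toReal_ofReal hr.le] at h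

/-- **The flux integrand is in `L^{p/3}`.** For `p > 3`, `U ∈ L^p(ℝ³)` and `P ∈ L^{p/2}(ℝ³)`,
`f = |U|³ + 2|P||U| ∈ L^{p/3}(ℝ³)` (`|U|³ ∈ L^{p/3}`; Hölder `1/(p/2) + 1/p = 1/(p/3)` for the
product) — the integrability behind CS13's "By the Hölder inequality we obtain …
`(∫_{L≤|y|} (|v|³ + |q||v|)^{p/3} dy)^{3/p}`". [cite: ChaeShvydkoy2013, §3.2.1 (Hölder step to (3.3))] -/
theorem memLp_flux_of_memLp {p : ℝ} (hp : 3 < p)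
    {U : EuclideanSpace ℝ (Fin 3) → EuclideanSpace ℝ (Fin 3)} {P : EuclideanSpace ℝ (Fin 3) → ℝ}
    (hU : MemLp U (ENNReal.ofReal p) volume) (hP : MemLp P (ENNReal.ofReal (p / 2)) volume) :
    MemLp (fun y => ‖U y‖ ^ 3 + 2 * (|P y| * ‖U y‖)) (ENNReal.ofReal (p / 3)) volume := by
  have hp0 : 0 < p := by linarith
  have h3 : ENNReal.ofReal p / 3 = ENNReal.ofReal (p / 3) := by
    rw [ENNReal.ofReal_div_of_pos (by norm_num : (0 : ℝ) < 3)]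
    norm_num
  have h1 : MemLp (fun y => ‖U y‖ ^ 3) (ENNReal.ofReal (p / 3)) volume := by
    have h := hU.norm_rpow_div (3 : ℝ≥0∞)
    rw [h3] at h
    refine h.congr_norm ?_ (Eventually.of_forall fun y => ?_)
    · exact (hU.1.norm.aemeasurable.pow_const _).aestronglyMeasurable
    · simp only [ENNReal.toReal_ofNat, Real.norm_eq_abs]
      rw [show (3 : ℝ) = ((3 : ℕ) : ℝ) by norm_num, Real.rpow_natCast]
  -- the Hölder triple `p/2, p, p/3`
  haveI : ENNReal.HolderTriple (ENNReal.ofReal (p / 2)) (ENNReal.ofReal p)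
      (ENNReal.ofReal (p / 3)) := by
    constructor
    rw [← ENNReal.ofReal_inv_of_pos (by positivity), ← ENNReal.ofReal_inv_of_pos hp0,
      ← ENNReal.ofReal_inv_of_pos (by positivity),
      ← ENNReal.ofReal_add (by positivity) (by positivity)]
    congr 1
    field_simp
    ring
  have hPabs : MemLp (fun y => |P y|) (ENNReal.ofReal (p / 2)) volume := by
    simpa [Real.norm_eq_abs] using hP.norm
  have h2 : MemLp (fun y => |P y| * ‖U y‖) (ENNReal.ofReal (p / 3)) volume :=
    MemLp.mul' hU.norm hPabs
  exact h1.add (h2.const_mul 2)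

/-- The flux integrand is nonnegative. [folklore] -/
private theorem flux_nonneg (U : EuclideanSpace ℝ (Fin 3) → EuclideanSpace ℝ (Fin 3))
    (P : EuclideanSpace ℝ (Fin 3) → ℝ) (y : EuclideanSpace ℝ (Fin 3)) :
    0 ≤ ‖U y‖ ^ 3 + 2 * (|P y| * ‖U y‖) := by positivity

/-- **Hölder against `1` for the flux, exponent `p/3`.** For `p > 3`, `f ∈ L^{p/3}(ℝ³)`
nonnegative and `S` bounded measurable... (any set of finite measure):
`∫_S f ≤ (∫_S f^{p/3})^{3/p} |S|^{1 − 3/p}`. [folklore] -/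
private theorem setIntegral_flux_le_rpow {p : ℝ} (hp : 3 < p)
    {f : EuclideanSpace ℝ (Fin 3) → ℝ} (hf0 : ∀ y, 0 ≤ f y)
    (hf : MemLp f (ENNReal.ofReal (p / 3)) volume)
    {S : Set (EuclideanSpace ℝ (Fin 3))} (hS : volume S ≠ ⊤) :
    ∫ y in S, f y ≤ (∫ y in S, f y ^ (p / 3)) ^ (3 / p) * (volume.real S) ^ (1 - 3 / p) := by
  have hr : 1 < p / 3 := by
    rw [lt_div_iff₀ (by norm_num : (0 : ℝ) < 3)]
    linarith
  have h := setIntegral_le_rpow_mul_measureReal_rpow hr hS hf0 (hf.restrict S)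
  have e1 : 1 / (p / 3) = 3 / p := by rw [one_div, inv_div]
  rwa [e1] at h

/-- **Radial weights off a ball are in `L^s`.** For `l > 0` and `1 ≤ s < ∞` with `m s > 3`, the
weight `y ↦ |y|^{−m}` belongs to `L^s` of `{|y| ≥ l}` and
`∫_{|y| ≥ l} (|y|^{−m})^s = 3|B₁| l^{3 − ms}/(ms − 3)`. [folklore] -/
private theorem memLp_norm_rpow_neg_compl_ball {m s l : ℝ} (hs : 1 ≤ s) (hms : 3 < m * s)
    (hl : 0 < l) :
    MemLp (fun y : EuclideanSpace ℝ (Fin 3) => ‖y‖ ^ (-m)) (ENNReal.ofReal s)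
      (volume.restrict (ball (0 : EuclideanSpace ℝ (Fin 3)) l)ᶜ) ∧
    ∫ y in (ball (0 : EuclideanSpace ℝ (Fin 3)) l)ᶜ, (‖y‖ ^ (-m)) ^ s =
      3 * (volume : Measure (EuclideanSpace ℝ (Fin 3))).real (ball 0 1) *
        (l ^ (3 - m * s) / (m * s - 3)) := by
  have hs0 : 0 < s := by linarith
  have hmeas : AEStronglyMeasurable (fun y : EuclideanSpace ℝ (Fin 3) => ‖y‖ ^ (-m))
      (volume.restrict (ball (0 : EuclideanSpace ℝ (Fin 3)) l)ᶜ) :=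
    (measurable_norm.pow_const (-m)).aestronglyMeasurable
  have hpt : ∀ y : EuclideanSpace ℝ (Fin 3), (‖y‖ ^ (-m)) ^ s = ‖y‖ ^ (-(m * s)) := fun y => by
    rw [← Real.rpow_mul (norm_nonneg _)]
    ring_nf
  have hint : IntegrableOn (fun y : EuclideanSpace ℝ (Fin 3) => ‖y‖ ^ (-(m * s)))
      (ball (0 : EuclideanSpace ℝ (Fin 3)) l)ᶜ volume :=
    NewtonPotentialHolder.integrableOn_compl_ball_norm_rpow_neg hms hl
  refine ⟨?_, ?_⟩
  · rw [← integrable_norm_rpow_iff hmeas (by simp [hs0]) ENNReal.ofReal_ne_top,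
      ENNReal.toReal_ofReal hs0.le]
    refine (hint.congr_fun (g := fun y : EuclideanSpace ℝ (Fin 3) => (‖y‖ ^ (-m)) ^ s)
      (fun y _ => (hpt y).symm) measurableSet_ball.compl).congr ?_
    refine Eventually.of_forall fun y => ?_
    simp only [Real.norm_eq_abs, abs_of_nonneg (Real.rpow_nonneg (norm_nonneg y) (-m))]
  · simp_rw [hpt]
    exact NewtonPotentialHolder.integral_compl_ball_norm_rpow_neg hms hl

/-- **Weighted Hölder for the flux off a ball.** For `p > 3`, `f ≥ 0` in `L^{p/3}(ℝ³)`,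
`m p/(p−3) > 3`, and `l > 0`:
`∫_{|y| ≥ l} |y|^{−m} f ≤ (3|B₁| l^{3 − mp/(p−3)}/(mp/(p−3) − 3))^{1 − 3/p} (∫ f^{p/3})^{3/p}`, and
the weighted flux is integrable off the ball — CS13's Hölder step "`(1/L^{N−2α})∫_{|y|≤L}|v|² ≤
C L^{2α−1−3N/p} (∫_{L≤|y|}(|v|³+|q||v|)^{p/3})^{3/p}`" with the weight `|y|^{−(N+1−2α)}`, `m = N+1−2α`.
[cite: ChaeShvydkoy2013, §3.2.1 (Hölder step to (3.3))] -/
theorem setIntegral_weight_mul_flux_le {p m l : ℝ} (hp : 3 < p)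
    (hms : 3 < m * (p / (p - 3))) (hl : 0 < l)
    {f : EuclideanSpace ℝ (Fin 3) → ℝ} (hf0 : ∀ y, 0 ≤ f y)
    (hf : MemLp f (ENNReal.ofReal (p / 3)) volume) :
    IntegrableOn (fun y : EuclideanSpace ℝ (Fin 3) => ‖y‖ ^ (-m) * f y)
      (ball (0 : EuclideanSpace ℝ (Fin 3)) l)ᶜ volume ∧
    ∫ y in (ball (0 : EuclideanSpace ℝ (Fin 3)) l)ᶜ, ‖y‖ ^ (-m) * f y ≤
      (3 * (volume : Measure (EuclideanSpace ℝ (Fin 3))).real (ball 0 1) *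
          (l ^ (3 - m * (p / (p - 3))) / (m * (p / (p - 3)) - 3))) ^ (1 - 3 / p) *
        (∫ y, f y ^ (p / 3)) ^ (3 / p) := by
  have hp3 : 0 < p - 3 := by linarith
  have hs : 1 ≤ p / (p - 3) := by
    rw [le_div_iff₀ hp3]
    linarith
  have hr : 1 < p / 3 := by
    rw [lt_div_iff₀ (by norm_num : (0 : ℝ) < 3)]
    linarith
  obtain ⟨hwLp, hwint⟩ := memLp_norm_rpow_neg_compl_ball hs hms hl
  have hpq : Real.HolderConjugate (p / (p - 3)) (p / 3) := by
    refine ⟨?_, by positivity, by positivity⟩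
    rw [inv_one, inv_div, inv_div]
    field_simp
    ring
  set μ : Measure (EuclideanSpace ℝ (Fin 3)) :=
    volume.restrict (ball (0 : EuclideanSpace ℝ (Fin 3)) l)ᶜ with hμ
  have hfμ : MemLp f (ENNReal.ofReal (p / 3)) μ := hf.restrict _
  -- integrability of the product (Hölder)
  have hprod : Integrable (fun y : EuclideanSpace ℝ (Fin 3) => ‖y‖ ^ (-m) * f y) μ := by
    haveI : ENNReal.HolderTriple (ENNReal.ofReal (p / (p - 3))) (ENNReal.ofReal (p / 3)) 1 := by
      constructor
      rw [← ENNReal.ofReal_inv_of_pos (by positivity), ← ENNReal.ofReal_inv_of_pos (by positivity),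
        ← ENNReal.ofReal_add (by positivity) (by positivity), inv_one]
      rw [← ENNReal.ofReal_one]
      congr 1
      rw [inv_div, inv_div]
      field_simp
      ring
    have h : MemLp (fun y : EuclideanSpace ℝ (Fin 3) => ‖y‖ ^ (-m) * f y) 1 μ :=
      MemLp.mul' hfμ hwLp
    exact memLp_one_iff_integrable.1 h
  refine ⟨hprod, ?_⟩
  have h := integral_mul_le_Lp_mul_Lq_of_nonneg (μ := μ) hpq
    (f := fun y : EuclideanSpace ℝ (Fin 3) => ‖y‖ ^ (-m)) (g := f)
    (Eventually.of_forall fun y => Real.rpow_nonneg (norm_nonneg _) _)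
    (Eventually.of_forall hf0) hwLp hfμ
  rw [hμ] at h
  rw [hwint] at h
  refine h.trans ?_
  have e1 : 1 / (p / (p - 3)) = 1 - 3 / p := by
    rw [one_div, inv_div]
    field_simp
  have e2 : 1 / (p / 3) = 3 / p := by rw [one_div, inv_div]
  rw [e1, e2]
  have hfi : Integrable (fun y => f y ^ (p / 3)) (volume : Measure (EuclideanSpace ℝ (Fin 3))) :=
    (integrable_norm_rpow_of_memLp_ofReal (by positivity) hf).congr
      (Eventually.of_forall fun y => by simp [Real.norm_eq_abs, abs_of_nonneg (hf0 y)])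
  have hI : ∫ y in (ball (0 : EuclideanSpace ℝ (Fin 3)) l)ᶜ, f y ^ (p / 3) ≤ ∫ y, f y ^ (p / 3) :=
    setIntegral_le_integral hfi (Eventually.of_forall fun y => Real.rpow_nonneg (hf0 y) _)
  have hms3 : 0 < m * (p / (p - 3)) - 3 := sub_pos.2 hms
  have hv : 0 ≤ (volume : Measure (EuclideanSpace ℝ (Fin 3))).real (ball 0 1) := measureReal_nonneg
  refine mul_le_mul_of_nonneg_left ?_ (Real.rpow_nonneg (by positivity) _)
  exact Real.rpow_le_rpow (integral_nonneg fun y => Real.rpow_nonneg (hf0 y) _) hI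
    (by positivity)

/-! ## Range `α > 3/2` for general `p`: ball energies against the LOCAL flux (CS13 §3.2.2) -/

/-- The flux `|U|³ + 2|P||U|` of a continuous field with locally integrable pressure is integrable
on closed balls. [folklore] -/
private theorem integrableOn_flux_closedBall
    {U : EuclideanSpace ℝ (Fin 3) → EuclideanSpace ℝ (Fin 3)} {P : EuclideanSpace ℝ (Fin 3) → ℝ}
    (hU : Continuous U) (hPloc : LocallyIntegrable P volume) (R : ℝ) :
    IntegrableOn (fun y => ‖U y‖ ^ 3 + 2 * (|P y| * ‖U y‖))
      (closedBall (0 : EuclideanSpace ℝ (Fin 3)) R) volume := by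
  have hK : IsCompact (closedBall (0 : EuclideanSpace ℝ (Fin 3)) R) := isCompact_closedBall _ _
  have h1 : IntegrableOn (fun y => ‖U y‖ ^ 3) (closedBall (0 : EuclideanSpace ℝ (Fin 3)) R)
      volume := (hU.norm.pow 3).continuousOn.integrableOn_compact hK
  have h2 : IntegrableOn (fun y => |P y| * ‖U y‖) (closedBall (0 : EuclideanSpace ℝ (Fin 3)) R)
      volume := by
    have hPi : IntegrableOn (fun y => |P y|) (closedBall (0 : EuclideanSpace ℝ (Fin 3)) R)
        volume := (hPloc.integrableOn_isCompact hK).norm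
    exact hPi.mul_continuousOn hU.norm.continuousOn hK
  exact h1.add (h2.const_mul 2)

/-- **Ball energies against the local flux, range `α > 3/2`** (Chae–Shvydkoy §3.2.2 with ONE
radial cut-off at scale `L`; the form of CS13 (3.9) that feeds the bootstrap). For a stationary
self-similar Euler profile `(U, P)` with exponent `γ = 1/(α+1)`, `α > 3/2`, `U ∈ C²` and `P`
locally integrable, there is `K ≥ 0` (`K = 4D(1+α)`, `|σ'| ≤ D`) with
`(2α − 3) ∫_{|y| < L/2} |U|² ≤ (K/L) ∫_{|y| ≤ L} (|U|³ + 2|P||U|)` for every `L > 0`: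
in the local energy identity with `Φ(t) = σ(2 − 2t/L²)` both left terms are nonnegative
(`2α − 3 > 0`, `Φ' ≤ 0`), and `|Φ'(|y|²)| |y| ≤ 2D/L` is supported in `|y| ≤ L`.
[cite: ChaeShvydkoy2013, §3.2.2 eq. (3.9)] -/
theorem IsSelfSimilarEulerProfile.ball_energy_le_localFlux {α : ℝ}
    {U : EuclideanSpace ℝ (Fin 3) → EuclideanSpace ℝ (Fin 3)} {P : EuclideanSpace ℝ (Fin 3) → ℝ}
    (h : IsSelfSimilarEulerProfile (1 / (α + 1)) 0 U P) (hα : 3 / 2 < α)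
    (hPloc : LocallyIntegrable P volume) :
    ∃ K : ℝ, 0 ≤ K ∧ ∀ L : ℝ, 0 < L →
      (2 * α - 3) * ∫ y in ball (0 : EuclideanSpace ℝ (Fin 3)) (L / 2), ‖U y‖ ^ 2 ≤
        K / L * ∫ y in closedBall (0 : EuclideanSpace ℝ (Fin 3)) L,
          (‖U y‖ ^ 3 + 2 * (|P y| * ‖U y‖)) := by
  have hα1 : α + 1 ≠ 0 := by
    intro h0
    linarith
  have hUc : Continuous U := h.contDiff_velocity.continuous
  obtain ⟨D, hD0, hD⟩ := Calculus.exists_bound_deriv_smoothTransition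
  refine ⟨(1 + α) * (4 * D), by nlinarith, fun L hL => ?_⟩
  set f : EuclideanSpace ℝ (Fin 3) → ℝ := fun y => ‖U y‖ ^ 3 + 2 * (|P y| * ‖U y‖) with hf_def
  have hflux : IntegrableOn f (closedBall (0 : EuclideanSpace ℝ (Fin 3)) L) volume :=
    integrableOn_flux_closedBall hUc hPloc L
  set a : ℝ := L ^ 2 with ha_def
  have ha : 0 < a := by positivity
  set Φ : ℝ → ℝ := fun t => Real.smoothTransition (2 - 2 / a * t) with hΦ_def
  have hΦ1 : ContDiff ℝ 1 Φ := outerCut_contDiff a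
  have hΦT : ∀ t, a ≤ t → Φ t = 0 := fun t ht => outerCut_eq_zero ha ht
  have key := h.localEnergy_identity_radial hα1 hΦ1 hΦT
  -- lower bound of the left-hand side (both terms are nonnegative)
  have hκ : ∀ y : EuclideanSpace ℝ (Fin 3),
      (2 * α - 3) * (ball (0 : EuclideanSpace ℝ (Fin 3)) (L / 2)).indicator
          (fun y => ‖U y‖ ^ 2) y ≤
        ((2 * α - 3) * Φ (‖y‖ ^ 2) - 2 * ‖y‖ ^ 2 * deriv Φ (‖y‖ ^ 2)) * ‖U y‖ ^ 2 := by
    intro y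
    have hd : deriv Φ (‖y‖ ^ 2) ≤ 0 := outerCut_deriv_nonpos ha _
    have hΦ0 : 0 ≤ Φ (‖y‖ ^ 2) := outerCut_nonneg a _
    have h2 : 0 ≤ -(2 * ‖y‖ ^ 2 * deriv Φ (‖y‖ ^ 2)) * ‖U y‖ ^ 2 := by
      have : 0 ≤ -deriv Φ (‖y‖ ^ 2) := by linarith
      have h' : 0 ≤ 2 * ‖y‖ ^ 2 * (-deriv Φ (‖y‖ ^ 2)) := by positivity
      nlinarith [sq_nonneg ‖U y‖]
    by_cases hy : y ∈ ball (0 : EuclideanSpace ℝ (Fin 3)) (L / 2)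
    · rw [indicator_of_mem hy]
      have hy' : ‖y‖ ^ 2 ≤ a / 2 := by
        rw [mem_ball_zero_iff] at hy
        have : ‖y‖ ^ 2 < (L / 2) ^ 2 := by
          gcongr
        nlinarith
      rw [show Φ (‖y‖ ^ 2) = 1 from outerCut_eq_one ha hy']
      nlinarith
    · rw [indicator_of_notMem hy, mul_zero]
      have h3 : 0 ≤ (2 * α - 3) * Φ (‖y‖ ^ 2) * ‖U y‖ ^ 2 := by
        have : 0 ≤ 2 * α - 3 := by linarith
        positivity
      nlinarith
  have hiL : Integrable (fun y => ((2 * α - 3) * Φ (‖y‖ ^ 2) -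
      2 * ‖y‖ ^ 2 * deriv Φ (‖y‖ ^ 2)) * ‖U y‖ ^ 2)
      (volume : Measure (EuclideanSpace ℝ (Fin 3))) := by
    have hc : Continuous fun y : EuclideanSpace ℝ (Fin 3) => ((2 * α - 3) * Φ (‖y‖ ^ 2) -
        2 * ‖y‖ ^ 2 * deriv Φ (‖y‖ ^ 2)) * ‖U y‖ ^ 2 := by
      have h1 : Continuous fun y : EuclideanSpace ℝ (Fin 3) => Φ (‖y‖ ^ 2) :=
        hΦ1.continuous.comp (continuous_norm.pow 2)
      have h2 : Continuous fun y : EuclideanSpace ℝ (Fin 3) => deriv Φ (‖y‖ ^ 2) :=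
        hΦ1.continuous_deriv_one.comp (continuous_norm.pow 2)
      exact ((continuous_const.mul h1).sub
        ((continuous_const.mul (continuous_norm.pow 2)).mul h2)).mul (hUc.norm.pow 2)
    refine hc.integrable_of_hasCompactSupport ?_
    refine HasCompactSupport.intro (isCompact_closedBall (0 : EuclideanSpace ℝ (Fin 3)) L)
      fun y hy => ?_
    rw [mem_closedBall_zero_iff, not_le] at hy
    have hy2 : a ≤ ‖y‖ ^ 2 := by
      rw [ha_def]
      gcongr
    simp only [show Φ (‖y‖ ^ 2) = 0 from outerCut_eq_zero ha hy2,
      show deriv Φ (‖y‖ ^ 2) = 0 from outerCut_deriv_eq_zero_of_le ha hy2]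
    ring
  have hiInd : Integrable (fun y => (2 * α - 3) *
      (ball (0 : EuclideanSpace ℝ (Fin 3)) (L / 2)).indicator (fun y => ‖U y‖ ^ 2) y)
      (volume : Measure (EuclideanSpace ℝ (Fin 3))) := by
    refine Integrable.const_mul ?_ _
    exact (((hUc.norm.pow 2).continuousOn.integrableOn_compact
      (isCompact_closedBall (0 : EuclideanSpace ℝ (Fin 3)) (L / 2))).mono_set
      ball_subset_closedBall).integrable_indicator measurableSet_ball
  have hlow : (2 * α - 3) * ∫ y in ball (0 : EuclideanSpace ℝ (Fin 3)) (L / 2), ‖U y‖ ^ 2 ≤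
      ∫ y, ((2 * α - 3) * Φ (‖y‖ ^ 2) - 2 * ‖y‖ ^ 2 * deriv Φ (‖y‖ ^ 2)) * ‖U y‖ ^ 2 := by
    rw [← integral_indicator measurableSet_ball, ← integral_const_mul]
    exact integral_mono hiInd hiL hκ
  -- upper bound of the right-hand side: the flux is supported in `|y| ≤ L`
  have hpt : ∀ y : EuclideanSpace ℝ (Fin 3),
      ‖(‖U y‖ ^ 2 + 2 * P y) * (2 * deriv Φ (‖y‖ ^ 2) * ⟪y, U y⟫)‖ ≤
        4 * D / L * (closedBall (0 : EuclideanSpace ℝ (Fin 3)) L).indicator f y := by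
    intro y
    by_cases hyL : y ∈ closedBall (0 : EuclideanSpace ℝ (Fin 3)) L
    · rw [indicator_of_mem hyL, hf_def]
      rw [mem_closedBall_zero_iff] at hyL
      rw [Real.norm_eq_abs, abs_mul, abs_mul, abs_mul]
      have hin : |⟪y, U y⟫| ≤ ‖y‖ * ‖U y‖ := abs_real_inner_le_norm _ _
      have hA : |‖U y‖ ^ 2 + 2 * P y| ≤ ‖U y‖ ^ 2 + 2 * |P y| := by
        calc |‖U y‖ ^ 2 + 2 * P y| ≤ |‖U y‖ ^ 2| + |2 * P y| := abs_add_le _ _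
          _ = ‖U y‖ ^ 2 + 2 * |P y| := by
              rw [abs_of_nonneg (by positivity), abs_mul, abs_two]
      have hyd : ‖y‖ * |deriv Φ (‖y‖ ^ 2)| ≤ 2 * D / L := by
        calc ‖y‖ * |deriv Φ (‖y‖ ^ 2)| ≤ L * (2 * D / a) := by
              gcongr
              exact abs_outerCut_deriv_le ha hD _
          _ = 2 * D / L := by
              rw [ha_def]
              field_simp
      have hU0 : 0 ≤ ‖U y‖ := norm_nonneg _
      calc |‖U y‖ ^ 2 + 2 * P y| * (|2| * |deriv Φ (‖y‖ ^ 2)| * |⟪y, U y⟫|)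
          ≤ (‖U y‖ ^ 2 + 2 * |P y|) * (2 * |deriv Φ (‖y‖ ^ 2)| * (‖y‖ * ‖U y‖)) := by
            rw [abs_two]
            gcongr
        _ = (‖U y‖ ^ 2 + 2 * |P y|) * ‖U y‖ * (2 * (‖y‖ * |deriv Φ (‖y‖ ^ 2)|)) := by ring
        _ ≤ (‖U y‖ ^ 2 + 2 * |P y|) * ‖U y‖ * (2 * (2 * D / L)) := by
            gcongr
        _ = 4 * D / L * (‖U y‖ ^ 3 + 2 * (|P y| * ‖U y‖)) := by ring
    · rw [indicator_of_notMem hyL, mul_zero]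
      rw [mem_closedBall_zero_iff, not_le] at hyL
      have hy2 : a ≤ ‖y‖ ^ 2 := by
        rw [ha_def]
        gcongr
      rw [show deriv Φ (‖y‖ ^ 2) = 0 from outerCut_deriv_eq_zero_of_le ha hy2]
      simp
  have hfi : Integrable (fun y => 4 * D / L *
      (closedBall (0 : EuclideanSpace ℝ (Fin 3)) L).indicator f y)
      (volume : Measure (EuclideanSpace ℝ (Fin 3))) :=
    (hflux.integrable_indicator measurableSet_closedBall).const_mul _
  have hup : ‖∫ y, (‖U y‖ ^ 2 + 2 * P y) * (2 * deriv Φ (‖y‖ ^ 2) * ⟪y, U y⟫)‖ ≤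
      4 * D / L * ∫ y in closedBall (0 : EuclideanSpace ℝ (Fin 3)) L, f y := by
    rw [← integral_indicator measurableSet_closedBall, ← integral_const_mul]
    exact norm_integral_le_of_norm_le hfi (Eventually.of_forall hpt)
  -- combine
  calc (2 * α - 3) * ∫ y in ball (0 : EuclideanSpace ℝ (Fin 3)) (L / 2), ‖U y‖ ^ 2
      ≤ (1 + α) * ∫ y, (‖U y‖ ^ 2 + 2 * P y) * (2 * deriv Φ (‖y‖ ^ 2) * ⟪y, U y⟫) := by
        rw [← key]
        exact hlow
    _ ≤ (1 + α) * ‖∫ y, (‖U y‖ ^ 2 + 2 * P y) * (2 * deriv Φ (‖y‖ ^ 2) * ⟪y, U y⟫)‖ :=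
        mul_le_mul_of_nonneg_left (Real.le_norm_self _) (by linarith)
    _ ≤ (1 + α) * (4 * D / L * ∫ y in closedBall (0 : EuclideanSpace ℝ (Fin 3)) L, f y) :=
        mul_le_mul_of_nonneg_left hup (by linarith)
    _ = (1 + α) * (4 * D) / L * ∫ y in closedBall (0 : EuclideanSpace ℝ (Fin 3)) L, f y := by
        rw [hf_def]
        ring

/-- **First growth bound, range `α > 3/2`, general `p`** (CS13 §3.2.2 before the bootstrap:
`∫_{|y| ≤ L} |v|² ≲ L^{β_p}`, `β_p = 2 − 9/p`, display after (3.9)). For `p > 3`, a profile with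
`α > 3/2`, `U ∈ L^p`, `P ∈ L^{p/2}`: `∫_{|y|<L} |U|² ≤ C L^{2 − 9/p}` for all `L > 0` (the local
flux on `|y| ≤ 2L` is `≤ ‖f‖_{p/3} |B_{2L}|^{1−3/p}`).
[cite: ChaeShvydkoy2013, §3.2.2 eq. (3.9)–(3.10)] -/
theorem IsSelfSimilarEulerProfile.energyGrowth_first_of_gt_three_halves {α p : ℝ}
    {U : EuclideanSpace ℝ (Fin 3) → EuclideanSpace ℝ (Fin 3)} {P : EuclideanSpace ℝ (Fin 3) → ℝ}
    (h : IsSelfSimilarEulerProfile (1 / (α + 1)) 0 U P) (hα : 3 / 2 < α) (hp : 3 < p)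
    (hU : MemLp U (ENNReal.ofReal p) volume) (hP : MemLp P (ENNReal.ofReal (p / 2)) volume) :
    ∃ C : ℝ, 0 ≤ C ∧ ∀ L : ℝ, 0 < L →
      ∫ y in ball (0 : EuclideanSpace ℝ (Fin 3)) L, ‖U y‖ ^ 2 ≤ C * L ^ (2 - 9 / p) := by
  have hp0 : 0 < p := by linarith
  have hPloc : LocallyIntegrable P volume :=
    hP.locallyIntegrable (by
      rw [← ENNReal.ofReal_one]
      exact ENNReal.ofReal_le_ofReal (by linarith))
  obtain ⟨K, hK0, hK⟩ := h.ball_energy_le_localFlux hα hPloc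
  set f : EuclideanSpace ℝ (Fin 3) → ℝ := fun y => ‖U y‖ ^ 3 + 2 * (|P y| * ‖U y‖) with hf_def
  have hfLp : MemLp f (ENNReal.ofReal (p / 3)) volume := memLp_flux_of_memLp hp hU hP
  have hf0 : ∀ y, 0 ≤ f y := flux_nonneg U P
  set F : ℝ := (∫ y, f y ^ (p / 3)) ^ (3 / p) with hF_def
  have hF0 : 0 ≤ F := Real.rpow_nonneg (integral_nonneg fun y => Real.rpow_nonneg (hf0 y) _) _
  have hfi : Integrable (fun y => f y ^ (p / 3)) (volume : Measure (EuclideanSpace ℝ (Fin 3))) :=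
    (integrable_norm_rpow_of_memLp_ofReal (by positivity) hfLp).congr
      (Eventually.of_forall fun y => by simp [Real.norm_eq_abs, abs_of_nonneg (hf0 y)])
  set v₁ : ℝ := (volume : Measure (EuclideanSpace ℝ (Fin 3))).real
    (closedBall (0 : EuclideanSpace ℝ (Fin 3)) 1) with hv₁_def
  have hv₁ : 0 ≤ v₁ := measureReal_nonneg
  have hα3 : 0 < 2 * α - 3 := by linarith
  -- local flux bound: `∫_{|y| ≤ R} f ≤ F (v₁ R³)^{1 − 3/p}`
  have hloc : ∀ R : ℝ, 0 < R → ∫ y in closedBall (0 : EuclideanSpace ℝ (Fin 3)) R, f y ≤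
      F * (v₁ * R ^ 3) ^ (1 - 3 / p) := by
    intro R hR
    have hvol : (volume : Measure (EuclideanSpace ℝ (Fin 3))).real
        (closedBall (0 : EuclideanSpace ℝ (Fin 3)) R) = v₁ * R ^ 3 := by
      rw [hv₁_def, Measure.addHaar_real_closedBall' volume (0 : EuclideanSpace ℝ (Fin 3)) hR.le,
        finrank_euclideanSpace_fin, mul_comm]
    have h1 := setIntegral_flux_le_rpow hp hf0 hfLp
      (S := closedBall (0 : EuclideanSpace ℝ (Fin 3)) R) measure_closedBall_lt_top.ne
    rw [hvol] at h1
    refine h1.trans ?_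
    have hI : ∫ y in closedBall (0 : EuclideanSpace ℝ (Fin 3)) R, f y ^ (p / 3) ≤
        ∫ y, f y ^ (p / 3) :=
      setIntegral_le_integral hfi (Eventually.of_forall fun y => Real.rpow_nonneg (hf0 y) _)
    have h13 : 0 ≤ 1 - 3 / p := by
      rw [sub_nonneg, div_le_one hp0]
      linarith
    exact mul_le_mul_of_nonneg_right
      (Real.rpow_le_rpow (integral_nonneg fun y => Real.rpow_nonneg (hf0 y) _) hI (by positivity))
      (Real.rpow_nonneg (by positivity) _)
  -- ball energies: `E(L) ≤ K/(2L)/(2α−3) · F (v₁ (2L)³)^{1−3/p} = C L^{2 − 9/p}`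
  refine ⟨K * F * (8 * v₁) ^ (1 - 3 / p) / (2 * (2 * α - 3)), by positivity, fun L hL => ?_⟩
  have h2L : 0 < 2 * L := by linarith
  have hb := hK (2 * L) h2L
  rw [show 2 * L / 2 = L by ring] at hb
  have hfl := hloc (2 * L) h2L
  have hE : ∫ y in ball (0 : EuclideanSpace ℝ (Fin 3)) L, ‖U y‖ ^ 2 ≤
      K / (2 * L) * (F * (v₁ * (2 * L) ^ 3) ^ (1 - 3 / p)) / (2 * α - 3) := by
    rw [le_div_iff₀ hα3, mul_comm]
    exact hb.trans (mul_le_mul_of_nonneg_left hfl (by positivity))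
  refine hE.trans (le_of_eq ?_)
  have hsplit : (v₁ * (2 * L) ^ 3) ^ (1 - 3 / p) = (8 * v₁) ^ (1 - 3 / p) * L ^ (3 - 9 / p) := by
    rw [show v₁ * (2 * L) ^ 3 = (8 * v₁) * L ^ 3 by ring,
      Real.mul_rpow (by positivity) (by positivity), ← Real.rpow_natCast,
      ← Real.rpow_mul hL.le]
    congr 1
    push_cast
    ring
  rw [hsplit]
  have hL9 : L ^ (3 - 9 / p) = L * L ^ (2 - 9 / p) := by
    rw [show (3 : ℝ) - 9 / p = 1 + (2 - 9 / p) by ring, Real.rpow_add hL, Real.rpow_one]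
  rw [hL9]
  field_simp

/-! ## Range `α ≤ 3/p` for general `p`: the weighted two-scale inequality (CS13 (3.2))

With the inner profile `Φ₁ ~ (|y|²/(2l²))^{−β}`, `β = 3/2 − α`, one has
`|Φ₁'(|y|²)| |y| ≲ l^{3−2α} |y|^{2α−4}` for `|y| ≥ l`: the flux of the local energy identity is
Chae–Shvydkoy's weighted tail `l^{N−2α} ∫_{|y| ≥ l} (|v|³ + |q||v|) |y|^{−(N+1−2α)}` of (3.2), while
the outer cut-off terms at scale `l₂` are `O(l₂^{2α − 6/p})` resp. `O(l₂^{2α − 1 − 9/p})` times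
`L^p`-tails and disappear as `l₂ → ∞` exactly when `α ≤ 3/p` (the `L^p`-scaling `α = N/p`). -/

/-- Decay of the inner profile's derivative: `|Φ₁'(t)| t ≤ (K₂ + β)(t/(2a))^{−β}` for `t ≥ a`
(on `[a, 2a]` from the package bound `|Φ₁'| t ≤ K₂` and `(t/(2a))^{−β} ≥ 1`; beyond `2a` from the
explicit formula `Φ₁(t) = (t/(2a))^{−β}`). [folklore] -/
private theorem innerCut_deriv_decay {β a K₂ : ℝ} (hβ : 0 ≤ β) (ha : 0 < a) (hK₂ : 0 ≤ K₂)
    {Φ₁ : ℝ → ℝ} (hΦ₁two : ∀ t, 2 * a ≤ t → Φ₁ t = (t / a / 2) ^ (-β))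
    (hΦ₁dec : ∀ t, a ≤ t → |deriv Φ₁ t| * t ≤ K₂) {t : ℝ} (ht : a ≤ t) :
    |deriv Φ₁ t| * t ≤ (K₂ + β) * (t / a / 2) ^ (-β) := by
  have ht0 : 0 < t := lt_of_lt_of_le ha ht
  have hx0 : 0 < t / a / 2 := by positivity
  by_cases h2 : t ≤ 2 * a
  · have hx1 : t / a / 2 ≤ 1 := by
      rw [div_le_one two_pos, div_le_iff₀ ha]
      linarith
    have hge : 1 ≤ (t / a / 2) ^ (-β) :=
      Real.one_le_rpow_of_pos_of_le_one_of_nonpos hx0 hx1 (by linarith)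
    calc |deriv Φ₁ t| * t ≤ K₂ := hΦ₁dec t ht
      _ ≤ (K₂ + β) * 1 := by linarith
      _ ≤ (K₂ + β) * (t / a / 2) ^ (-β) := by gcongr
  · push Not at h2
    have hev : Φ₁ =ᶠ[𝓝 t] fun s => (s / a / 2) ^ (-β) := by
      filter_upwards [Ioi_mem_nhds h2] with s hs using hΦ₁two s hs.le
    have h1 : HasDerivAt (fun s : ℝ => s / a / 2) (1 / a / 2) t := by
      have := ((hasDerivAt_id t).div_const a).div_const 2
      simpa using this
    have hg : HasDerivAt (fun s : ℝ => (s / a / 2) ^ (-β))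
        (1 / a / 2 * (-β) * (t / a / 2) ^ (-β - 1)) t := h1.rpow_const (Or.inl hx0.ne')
    rw [hev.deriv_eq, hg.deriv]
    have hid : (t / a / 2) ^ (-β - 1) * t = (t / a / 2) ^ (-β) * (2 * a) := by
      have e : (t / a / 2) ^ (-β) = (t / a / 2) ^ (-β - 1) * (t / a / 2) := by
        rw [← Real.rpow_add_one hx0.ne']
        ring_nf
      rw [e]
      field_simp
    have hxβ : 0 ≤ (t / a / 2) ^ (-β) := Real.rpow_nonneg hx0.le _
    calc |1 / a / 2 * -β * (t / a / 2) ^ (-β - 1)| * t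
        = β * (1 / a / 2) * ((t / a / 2) ^ (-β - 1) * t) := by
          rw [abs_mul, abs_mul, abs_neg, abs_of_nonneg hβ, abs_of_pos (by positivity),
            abs_of_nonneg (Real.rpow_nonneg hx0.le _)]
          ring
      _ = β * (t / a / 2) ^ (-β) := by
          rw [hid]
          field_simp
      _ ≤ (K₂ + β) * (t / a / 2) ^ (-β) := by
          gcongr
          linarith

/-- `(r²/l²/2)^{−β} = 2^β l^{2β} r^{−2β}` for `r, l > 0`. [folklore] -/
private theorem ratio_rpow_neg {r l β : ℝ} (hr : 0 < r) (hl : 0 < l) :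
    (r ^ 2 / l ^ 2 / 2) ^ (-β) = (2 : ℝ) ^ β * l ^ (2 * β) * r ^ (-(2 * β)) := by
  have e1 : (r ^ 2 : ℝ) ^ (-β) = r ^ (-(2 * β)) := by
    rw [← Real.rpow_natCast, ← Real.rpow_mul hr.le]
    congr 1
    push_cast
    ring
  have e2 : (l ^ 2 : ℝ) ^ (-β) = (l ^ (2 * β))⁻¹ := by
    rw [← Real.rpow_natCast, ← Real.rpow_mul hl.le, ← Real.rpow_neg hl.le]
    congr 1
    push_cast
    ring
  have e3 : (2 : ℝ) ^ (-β) = ((2 : ℝ) ^ β)⁻¹ := Real.rpow_neg (by norm_num) β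
  rw [Real.div_rpow (by positivity) (by norm_num), Real.div_rpow (by positivity) (by positivity),
    e1, e2, e3]
  have h2 : (0 : ℝ) < (2 : ℝ) ^ β := Real.rpow_pos_of_pos two_pos β
  have hl2 : (0 : ℝ) < l ^ (2 * β) := Real.rpow_pos_of_pos hl _
  field_simp

/-- **The inner weight.** With `a = l²`, `β ≥ 0` and the inner profile of `exists_innerCut`, for
`|y| ≥ l`: `|Φ₁'(|y|²)| |y| ≤ (K₂ + β) 2^β l^{2β} |y|^{−2β−1}`. [folklore] -/
private theorem innerCut_radial_weight {β l K₂ : ℝ} (hβ : 0 ≤ β) (hl : 0 < l) (hK₂ : 0 ≤ K₂)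
    {Φ₁ : ℝ → ℝ} (hΦ₁two : ∀ t, 2 * l ^ 2 ≤ t → Φ₁ t = (t / l ^ 2 / 2) ^ (-β))
    (hΦ₁dec : ∀ t, l ^ 2 ≤ t → |deriv Φ₁ t| * t ≤ K₂)
    {y : EuclideanSpace ℝ (Fin 3)} (hy : l ≤ ‖y‖) :
    |deriv Φ₁ (‖y‖ ^ 2)| * ‖y‖ ≤
      (K₂ + β) * (2 : ℝ) ^ β * l ^ (2 * β) * ‖y‖ ^ (-(2 * β) - 1) := by
  have hr : 0 < ‖y‖ := lt_of_lt_of_le hl hy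
  have ha : 0 < l ^ 2 := by positivity
  have hta : l ^ 2 ≤ ‖y‖ ^ 2 := pow_le_pow_left₀ hl.le hy 2
  have h1 := innerCut_deriv_decay hβ ha hK₂ hΦ₁two hΦ₁dec hta
  rw [ratio_rpow_neg hr hl] at h1
  have e : ‖y‖ ^ (-(2 * β) - 1) = ‖y‖ ^ (-(2 * β)) / ‖y‖ := Real.rpow_sub_one hr.ne' _
  rw [e, ← mul_div_assoc, le_div_iff₀ hr]
  calc |deriv Φ₁ (‖y‖ ^ 2)| * ‖y‖ * ‖y‖ = |deriv Φ₁ (‖y‖ ^ 2)| * ‖y‖ ^ 2 := by ring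
    _ ≤ (K₂ + β) * ((2 : ℝ) ^ β * l ^ (2 * β) * ‖y‖ ^ (-(2 * β))) := h1
    _ = (K₂ + β) * (2 : ℝ) ^ β * l ^ (2 * β) * ‖y‖ ^ (-(2 * β)) := by ring

/-- **The inner profile on the outer annulus.** For `|y|² ≥ l₂²/2` with `l₂ ≥ 2l`:
`Φ₁(|y|²) ≤ 8^β l^{2β} l₂^{−2β}`. [folklore] -/
private theorem innerCut_outer_bound {β l l₂ : ℝ} (hβ : 0 ≤ β) (hl : 0 < l) (hl₂ : 2 * l ≤ l₂)
    {Φ₁ : ℝ → ℝ} (hΦ₁two : ∀ t, 2 * l ^ 2 ≤ t → Φ₁ t = (t / l ^ 2 / 2) ^ (-β))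
    {y : EuclideanSpace ℝ (Fin 3)} (hy : l₂ ^ 2 / 2 ≤ ‖y‖ ^ 2) :
    Φ₁ (‖y‖ ^ 2) ≤ (8 : ℝ) ^ β * l ^ (2 * β) * l₂ ^ (-(2 * β)) := by
  have hl₂0 : 0 < l₂ := by linarith
  have hr : 0 < ‖y‖ := by
    rcases (norm_nonneg y).eq_or_lt with h0 | h0
    · exfalso
      rw [← h0] at hy
      nlinarith
    · exact h0
  have h2a : 2 * l ^ 2 ≤ ‖y‖ ^ 2 := by nlinarith
  rw [hΦ₁two _ h2a, ratio_rpow_neg hr hl]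
  have hyl : l₂ / 2 ≤ ‖y‖ := by
    by_contra hc
    push Not at hc
    have h1 : ‖y‖ ^ 2 < (l₂ / 2) ^ 2 := by
      exact pow_lt_pow_left₀ hc (norm_nonneg _) two_ne_zero
    nlinarith
  have hmono : ‖y‖ ^ (-(2 * β)) ≤ (l₂ / 2) ^ (-(2 * β)) :=
    Real.rpow_le_rpow_of_nonpos (by positivity) hyl (by linarith)
  have e : (l₂ / 2 : ℝ) ^ (-(2 * β)) = (4 : ℝ) ^ β * l₂ ^ (-(2 * β)) := by
    rw [Real.div_rpow hl₂0.le (by norm_num), Real.rpow_neg (by norm_num : (0 : ℝ) ≤ 2),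
      show ((2 : ℝ) ^ (2 * β)) = (4 : ℝ) ^ β by
        rw [Real.rpow_mul (by norm_num)]; norm_num]
    have h4 : (0 : ℝ) < (4 : ℝ) ^ β := Real.rpow_pos_of_pos (by norm_num) β
    field_simp
  have e8 : (8 : ℝ) ^ β = (2 : ℝ) ^ β * (4 : ℝ) ^ β := by
    rw [← Real.mul_rpow (by norm_num) (by norm_num)]
    norm_num
  rw [e8]
  have h2 : (0 : ℝ) ≤ (2 : ℝ) ^ β := Real.rpow_nonneg (by norm_num) β
  have hl2 : (0 : ℝ) ≤ l ^ (2 * β) := Real.rpow_nonneg hl.le _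
  calc (2 : ℝ) ^ β * l ^ (2 * β) * ‖y‖ ^ (-(2 * β))
      ≤ (2 : ℝ) ^ β * l ^ (2 * β) * ((l₂ / 2) ^ (-(2 * β))) := by gcongr
    _ = (2 : ℝ) ^ β * (4 : ℝ) ^ β * l ^ (2 * β) * l₂ ^ (-(2 * β)) := by rw [e]; ring

/-- **(P3ʷ) The outer energy weight, pointwise.** If `Φ₁(|y|²) ≤ θ` on `|y|² ≥ b/2` and
`|Φ₂'| ≤ 2D/b` with `Φ₂' = 0` off `(b/2, b)`, then
`2tΦ₁(t)(−Φ₂'(t))|U|² ≤ 4Dθ 1_S |U|²`, `S = {b/2 ≤ |y|²} ∩ {|y| ≤ l₂}`, `b = l₂²`. [folklore] -/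
private theorem weighted_P3 {b D θ l₂ : ℝ} {Φ₁ Φ₂ : ℝ → ℝ}
    (U : EuclideanSpace ℝ (Fin 3) → EuclideanSpace ℝ (Fin 3)) (hl₂ : 0 < l₂)
    (hb : b = l₂ ^ 2) (hD0 : 0 ≤ D) (hθ : 0 ≤ θ)
    (hΦ₁out : ∀ y : EuclideanSpace ℝ (Fin 3), b / 2 ≤ ‖y‖ ^ 2 → Φ₁ (‖y‖ ^ 2) ≤ θ)
    (hΦ₁nn : ∀ t, 0 < t → 0 ≤ Φ₁ t)
    (hΦ₂d0 : ∀ t, deriv Φ₂ t ≤ 0) (hΦ₂dle : ∀ t, |deriv Φ₂ t| ≤ 2 * D / b)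
    (hΦ₂d_half : ∀ t, t ≤ b / 2 → deriv Φ₂ t = 0) (hΦ₂d_b : ∀ t, b ≤ t → deriv Φ₂ t = 0)
    (y : EuclideanSpace ℝ (Fin 3)) :
    2 * ‖y‖ ^ 2 * Φ₁ (‖y‖ ^ 2) * (-deriv Φ₂ (‖y‖ ^ 2)) * ‖U y‖ ^ 2 ≤
      4 * D * θ * ({y : EuclideanSpace ℝ (Fin 3) | b / 2 ≤ ‖y‖ ^ 2} ∩
        closedBall (0 : EuclideanSpace ℝ (Fin 3)) l₂).indicator (fun y => ‖U y‖ ^ 2) y := by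
  have hb0 : 0 < b := by rw [hb]; positivity
  have hind0 : 0 ≤ 4 * D * θ * ({y : EuclideanSpace ℝ (Fin 3) | b / 2 ≤ ‖y‖ ^ 2} ∩
      closedBall (0 : EuclideanSpace ℝ (Fin 3)) l₂).indicator (fun y => ‖U y‖ ^ 2) y := by
    have : 0 ≤ ({y : EuclideanSpace ℝ (Fin 3) | b / 2 ≤ ‖y‖ ^ 2} ∩
        closedBall (0 : EuclideanSpace ℝ (Fin 3)) l₂).indicator (fun y => ‖U y‖ ^ 2) y :=
      indicator_nonneg (fun _ _ => by positivity) _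
    positivity
  by_cases h1 : ‖y‖ ^ 2 ≤ b / 2
  · rw [hΦ₂d_half _ h1, neg_zero, mul_zero, zero_mul]
    exact hind0
  by_cases h2 : b ≤ ‖y‖ ^ 2
  · rw [hΦ₂d_b _ h2, neg_zero, mul_zero, zero_mul]
    exact hind0
  push Not at h1 h2
  have hyS : y ∈ {y : EuclideanSpace ℝ (Fin 3) | b / 2 ≤ ‖y‖ ^ 2} ∩
      closedBall (0 : EuclideanSpace ℝ (Fin 3)) l₂ := by
    refine ⟨h1.le, ?_⟩
    rw [mem_closedBall_zero_iff]
    rw [hb] at h2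
    exact le_of_lt (lt_of_pow_lt_pow_left₀ 2 hl₂.le h2)
  rw [indicator_of_mem hyS]
  have hd : -deriv Φ₂ (‖y‖ ^ 2) ≤ 2 * D / b := by
    have := hΦ₂dle (‖y‖ ^ 2)
    rw [abs_le] at this
    linarith
  have hd0 : 0 ≤ -deriv Φ₂ (‖y‖ ^ 2) := by linarith [hΦ₂d0 (‖y‖ ^ 2)]
  have hΦ₁0 : 0 ≤ Φ₁ (‖y‖ ^ 2) := hΦ₁nn _ (by linarith)
  have hΦ₁θ : Φ₁ (‖y‖ ^ 2) ≤ θ := hΦ₁out y h1.le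
  have step : 2 * ‖y‖ ^ 2 * Φ₁ (‖y‖ ^ 2) * (-deriv Φ₂ (‖y‖ ^ 2)) ≤
      2 * b * θ * (2 * D / b) := by
    have e1 : 2 * ‖y‖ ^ 2 ≤ 2 * b := by linarith
    exact mul_le_mul (mul_le_mul e1 hΦ₁θ hΦ₁0 (by positivity)) hd hd0 (by positivity)
  calc 2 * ‖y‖ ^ 2 * Φ₁ (‖y‖ ^ 2) * (-deriv Φ₂ (‖y‖ ^ 2)) * ‖U y‖ ^ 2
      ≤ 2 * b * θ * (2 * D / b) * ‖U y‖ ^ 2 :=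
        mul_le_mul_of_nonneg_right step (sq_nonneg _)
    _ = 4 * D * θ * ‖U y‖ ^ 2 := by
        field_simp
        ring

/-- **(P2ʷ) The flux integrand, pointwise, with the radial weight.** With `Φ = Φ₁Φ₂`,
`|Φ₁'(|y|²)| |y| ≤ C_in |y|^{−2β−1}` for `|y| ≥ l` (and `Φ₁' = 0` on `|y| ≤ l`), `Φ₁ ≤ θ` on the
outer annulus, `|Φ₂'| ≤ 2D/b` supported in `(b/2, b)`, `b = l₂²`:
`|(|U|²+2P)(2Φ'⟪y,U⟫)| ≤ 2C_in 1_{|y| ≥ l} |y|^{−2β−1} f + (4Dθ/l₂) 1_S f`, `f = |U|³ + 2|P||U|`.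
[folklore] -/
private theorem weighted_P2 {β b D θ l l₂ Cin : ℝ} {Φ₁ Φ₂ : ℝ → ℝ}
    (U : EuclideanSpace ℝ (Fin 3) → EuclideanSpace ℝ (Fin 3)) (P : EuclideanSpace ℝ (Fin 3) → ℝ)
    (hl₂ : 0 < l₂) (hb : b = l₂ ^ 2) (hD0 : 0 ≤ D) (hθ : 0 ≤ θ)
    (hΦ₁d0 : ∀ t, t ≤ l ^ 2 → deriv Φ₁ t = 0)
    (hin : ∀ y : EuclideanSpace ℝ (Fin 3), l ≤ ‖y‖ →
      |deriv Φ₁ (‖y‖ ^ 2)| * ‖y‖ ≤ Cin * ‖y‖ ^ (-(2 * β) - 1))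
    (hΦ₁nn : ∀ t, 0 < t → 0 ≤ Φ₁ t)
    (hΦ₁out : ∀ y : EuclideanSpace ℝ (Fin 3), b / 2 ≤ ‖y‖ ^ 2 → Φ₁ (‖y‖ ^ 2) ≤ θ)
    (hΦ₂nn : ∀ t, 0 ≤ Φ₂ t) (hΦ₂le : ∀ t, Φ₂ t ≤ 1) (hΦ₂dle : ∀ t, |deriv Φ₂ t| ≤ 2 * D / b)
    (hΦ₂d_half : ∀ t, t ≤ b / 2 → deriv Φ₂ t = 0) (hΦ₂d_b : ∀ t, b ≤ t → deriv Φ₂ t = 0)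
    (hΦd : ∀ t, deriv (fun t => Φ₁ t * Φ₂ t) t = deriv Φ₁ t * Φ₂ t + Φ₁ t * deriv Φ₂ t)
    (y : EuclideanSpace ℝ (Fin 3)) :
    ‖(‖U y‖ ^ 2 + 2 * P y) * (2 * deriv (fun t => Φ₁ t * Φ₂ t) (‖y‖ ^ 2) * ⟪y, U y⟫)‖ ≤
      2 * Cin * (ball (0 : EuclideanSpace ℝ (Fin 3)) l)ᶜ.indicator
          (fun y => ‖y‖ ^ (-(2 * β) - 1) * (‖U y‖ ^ 3 + 2 * (|P y| * ‖U y‖))) y +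
        4 * D * θ / l₂ * ({y : EuclideanSpace ℝ (Fin 3) | b / 2 ≤ ‖y‖ ^ 2} ∩
          closedBall (0 : EuclideanSpace ℝ (Fin 3)) l₂).indicator
            (fun y => ‖U y‖ ^ 3 + 2 * (|P y| * ‖U y‖)) y := by
  have hb0 : 0 < b := by rw [hb]; positivity
  set f : ℝ := ‖U y‖ ^ 3 + 2 * (|P y| * ‖U y‖) with hf
  have hf0 : 0 ≤ f := by positivity
  -- the two indicator terms are nonnegative
  set TA : ℝ := (ball (0 : EuclideanSpace ℝ (Fin 3)) l)ᶜ.indicator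
    (fun y => ‖y‖ ^ (-(2 * β) - 1) * (‖U y‖ ^ 3 + 2 * (|P y| * ‖U y‖))) y with hTA
  set TB : ℝ := ({y : EuclideanSpace ℝ (Fin 3) | b / 2 ≤ ‖y‖ ^ 2} ∩
    closedBall (0 : EuclideanSpace ℝ (Fin 3)) l₂).indicator
      (fun y => ‖U y‖ ^ 3 + 2 * (|P y| * ‖U y‖)) y with hTB
  have hTA0 : 0 ≤ TA :=
    indicator_nonneg (fun z _ => mul_nonneg (Real.rpow_nonneg (norm_nonneg _) _)
      (flux_nonneg U P z)) _
  have hTB0 : 0 ≤ TB := indicator_nonneg (fun z _ => flux_nonneg U P z) _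
  -- inner part: `|Φ₁'(t) Φ₂(t)| |y| f ≤ Cin · TA`
  have hT1 : |deriv Φ₁ (‖y‖ ^ 2) * Φ₂ (‖y‖ ^ 2)| * ‖y‖ * f ≤ Cin * TA := by
    by_cases hyl : y ∈ (ball (0 : EuclideanSpace ℝ (Fin 3)) l)ᶜ
    · rw [hTA, indicator_of_mem hyl]
      have hyl' : l ≤ ‖y‖ := by simpa [mem_ball_zero_iff] using hyl
      calc |deriv Φ₁ (‖y‖ ^ 2) * Φ₂ (‖y‖ ^ 2)| * ‖y‖ * f
          ≤ |deriv Φ₁ (‖y‖ ^ 2)| * 1 * ‖y‖ * f := by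
            rw [abs_mul]
            gcongr
            rw [abs_of_nonneg (hΦ₂nn _)]
            exact hΦ₂le _
        _ = |deriv Φ₁ (‖y‖ ^ 2)| * ‖y‖ * f := by ring
        _ ≤ Cin * ‖y‖ ^ (-(2 * β) - 1) * f :=
            mul_le_mul_of_nonneg_right (hin y hyl') hf0
        _ = Cin * (‖y‖ ^ (-(2 * β) - 1) * (‖U y‖ ^ 3 + 2 * (|P y| * ‖U y‖))) := by
            rw [hf]
            ring
    · rw [hTA, indicator_of_notMem hyl, mul_zero]
      have hyl' : ‖y‖ ^ 2 ≤ l ^ 2 := by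
        rw [mem_compl_iff, not_not, mem_ball_zero_iff] at hyl
        exact pow_le_pow_left₀ (norm_nonneg _) hyl.le 2
      rw [hΦ₁d0 _ hyl', zero_mul, abs_zero, zero_mul, zero_mul]
  -- outer part: `Φ₁(t) |Φ₂'(t)| |y| f ≤ (2Dθ/l₂) · TB`
  have hT2 : |Φ₁ (‖y‖ ^ 2) * deriv Φ₂ (‖y‖ ^ 2)| * ‖y‖ * f ≤ 2 * D * θ / l₂ * TB := by
    by_cases h1 : ‖y‖ ^ 2 ≤ b / 2
    · rw [hΦ₂d_half _ h1, mul_zero, abs_zero, zero_mul, zero_mul]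
      positivity
    by_cases h2 : b ≤ ‖y‖ ^ 2
    · rw [hΦ₂d_b _ h2, mul_zero, abs_zero, zero_mul, zero_mul]
      positivity
    push Not at h1 h2
    have hyl₂ : ‖y‖ ≤ l₂ := by
      rw [hb] at h2
      exact le_of_lt (lt_of_pow_lt_pow_left₀ 2 hl₂.le h2)
    have hyS : y ∈ {y : EuclideanSpace ℝ (Fin 3) | b / 2 ≤ ‖y‖ ^ 2} ∩
        closedBall (0 : EuclideanSpace ℝ (Fin 3)) l₂ := ⟨h1.le, mem_closedBall_zero_iff.2 hyl₂⟩
    rw [hTB, indicator_of_mem hyS, ← hf]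
    have hΦ₁0 : 0 ≤ Φ₁ (‖y‖ ^ 2) := hΦ₁nn _ (by linarith)
    rw [abs_mul, abs_of_nonneg hΦ₁0]
    calc Φ₁ (‖y‖ ^ 2) * |deriv Φ₂ (‖y‖ ^ 2)| * ‖y‖ * f ≤ θ * (2 * D / b) * l₂ * f := by
          gcongr
          · exact hΦ₁out y h1.le
          · exact hΦ₂dle _
      _ = 2 * D * θ / l₂ * f := by
          rw [hb]
          field_simp
  -- combine
  have hDφ : |deriv (fun t => Φ₁ t * Φ₂ t) (‖y‖ ^ 2)| * ‖y‖ * f ≤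
      Cin * TA + 2 * D * θ / l₂ * TB := by
    rw [hΦd]
    calc |deriv Φ₁ (‖y‖ ^ 2) * Φ₂ (‖y‖ ^ 2) + Φ₁ (‖y‖ ^ 2) * deriv Φ₂ (‖y‖ ^ 2)| * ‖y‖ * f
        ≤ (|deriv Φ₁ (‖y‖ ^ 2) * Φ₂ (‖y‖ ^ 2)| + |Φ₁ (‖y‖ ^ 2) * deriv Φ₂ (‖y‖ ^ 2)|) *
            ‖y‖ * f := by
          gcongr
          exact abs_add_le _ _
      _ = |deriv Φ₁ (‖y‖ ^ 2) * Φ₂ (‖y‖ ^ 2)| * ‖y‖ * f +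
            |Φ₁ (‖y‖ ^ 2) * deriv Φ₂ (‖y‖ ^ 2)| * ‖y‖ * f := by ring
      _ ≤ Cin * TA + 2 * D * θ / l₂ * TB := add_le_add hT1 hT2
  rw [Real.norm_eq_abs, abs_mul, abs_mul, abs_mul]
  have hin' : |⟪y, U y⟫| ≤ ‖y‖ * ‖U y‖ := abs_real_inner_le_norm _ _
  have hA : |‖U y‖ ^ 2 + 2 * P y| ≤ ‖U y‖ ^ 2 + 2 * |P y| := by
    calc |‖U y‖ ^ 2 + 2 * P y| ≤ |‖U y‖ ^ 2| + |2 * P y| := abs_add_le _ _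
      _ = ‖U y‖ ^ 2 + 2 * |P y| := by
          rw [abs_of_nonneg (by positivity), abs_mul, abs_two]
  calc |‖U y‖ ^ 2 + 2 * P y| * (|2| * |deriv (fun t => Φ₁ t * Φ₂ t) (‖y‖ ^ 2)| * |⟪y, U y⟫|)
      ≤ (‖U y‖ ^ 2 + 2 * |P y|) *
          (2 * |deriv (fun t => Φ₁ t * Φ₂ t) (‖y‖ ^ 2)| * (‖y‖ * ‖U y‖)) := by
        rw [abs_two]
        gcongr
    _ = 2 * (|deriv (fun t => Φ₁ t * Φ₂ t) (‖y‖ ^ 2)| * ‖y‖ * f) := by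
        rw [hf]
        ring
    _ ≤ 2 * (Cin * TA + 2 * D * θ / l₂ * TB) := by gcongr
    _ = 2 * Cin * TA + 4 * D * θ / l₂ * TB := by ring
set_option maxHeartbeats 400000 in -- buildfix (bf3-g26): 160k/180k FAIL, 200k PASS at accept time; line-neutral budget line
/-- **The weighted two-scale inequality = Chae–Shvydkoy's (3.2), general `p`.** For `p > 3`, a
stationary self-similar Euler profile `(U, P)` with exponent `γ = 1/(α+1)`, `−1 < α ≤ 3/p`,
`U ∈ C² ∩ L^p(ℝ³)`, `P ∈ L^{p/2}(ℝ³)`, there is `K ≥ 0` (depending on `α` and the cut-off only)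
such that for every `l > 0`
`(3 − 2α) ∫_{|y| < l} |U|² ≤ K l^{3−2α} ∫_{|y| ≥ l} |y|^{2α−4} (|U|³ + 2|P||U|) dy`
— CS13 (3.2): "`(1/L^{N−2α}) ∫_{|y| ≤ L} |v|² ≤ C ∫_{L ≤ |y|} (|v|³ + |q||v|)/|y|^{N+1−2α}`". Proof:
the radial local energy identity with `Φ = Φ₁Φ₂` (inner profile `~(|y|²/(2l²))^{α−3/2}`, outer
cut-off at scale `l₂`); the inner flux is the weighted tail, and the two outer terms are
`≲ l₂^{2α−6/p} ‖U‖²_{L^p(|y|² ≥ l₂²/2)}` and `≲ l₂^{2α−1−9/p} ‖f‖_{L^{p/3}(|y|² ≥ l₂²/2)}`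
(Hölder), which tend to `0` as `l₂ → ∞` because `2α ≤ 6/p` — the role of the hypothesis
`α ≤ N/p`. [cite: ChaeShvydkoy2013, §3.2.1 eq. (3.2)] -/
theorem IsSelfSimilarEulerProfile.ball_energy_le_weightedFlux {α p : ℝ}
    {U : EuclideanSpace ℝ (Fin 3) → EuclideanSpace ℝ (Fin 3)} {P : EuclideanSpace ℝ (Fin 3) → ℝ}
    (h : IsSelfSimilarEulerProfile (1 / (α + 1)) 0 U P) (hα : -1 < α) (hp : 3 < p)
    (hαp : α ≤ 3 / p) (hU : MemLp U (ENNReal.ofReal p) volume)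
    (hP : MemLp P (ENNReal.ofReal (p / 2)) volume) :
    ∃ K : ℝ, 0 ≤ K ∧ ∀ l : ℝ, 0 < l →
      (3 - 2 * α) * ∫ y in ball (0 : EuclideanSpace ℝ (Fin 3)) l, ‖U y‖ ^ 2 ≤
        K * l ^ (3 - 2 * α) * ∫ y in (ball (0 : EuclideanSpace ℝ (Fin 3)) l)ᶜ,
          ‖y‖ ^ (2 * α - 4) * (‖U y‖ ^ 3 + 2 * (|P y| * ‖U y‖)) := by
  have hα0 : α + 1 ≠ 0 := by
    intro h0
    linarith
  have hp0 : 0 < p := by linarith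
  have hαp' : α * p ≤ 3 := by
    have := mul_le_mul_of_nonneg_right hαp hp0.le
    rwa [div_mul_cancel₀ _ hp0.ne'] at this
  have hα1 : α < 1 := by
    have : 3 / p < 1 := by rw [div_lt_one hp0]; linarith
    linarith
  have hUc : Continuous U := h.contDiff_velocity.continuous
  set β : ℝ := 3 / 2 - α with hβ_def
  have hβ0 : 0 ≤ β := by rw [hβ_def]; linarith
  obtain ⟨D, hD0, hD⟩ := Calculus.exists_bound_deriv_smoothTransition
  set K₂ : ℝ := (D + β) * (2 : ℝ) ^ (β + 1) with hK₂_def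
  have hK₂ : 0 ≤ K₂ := by positivity
  set Cβ : ℝ := (K₂ + β) * (2 : ℝ) ^ β with hCβ_def
  have hCβ : 0 ≤ Cβ := by positivity
  -- the flux integrand and its tails
  set f : EuclideanSpace ℝ (Fin 3) → ℝ := fun y => ‖U y‖ ^ 3 + 2 * (|P y| * ‖U y‖) with hf_def
  have hf0 : ∀ y, 0 ≤ f y := flux_nonneg U P
  have hfLp : MemLp f (ENNReal.ofReal (p / 3)) volume := memLp_flux_of_memLp hp hU hP
  have hfi : Integrable (fun y => f y ^ (p / 3)) (volume : Measure (EuclideanSpace ℝ (Fin 3))) :=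
    (integrable_norm_rpow_of_memLp_ofReal (by positivity) hfLp).congr
      (Eventually.of_forall fun y => by simp [Real.norm_eq_abs, abs_of_nonneg (hf0 y)])
  have hUpi : Integrable (fun y => ‖U y‖ ^ p) (volume : Measure (EuclideanSpace ℝ (Fin 3))) :=
    integrable_norm_rpow_of_memLp_ofReal hp0 hU
  set τU : ℝ → ℝ := fun r => ∫ y in {y : EuclideanSpace ℝ (Fin 3) | r ≤ ‖y‖ ^ 2}, ‖U y‖ ^ p
    with hτU_def
  set τf : ℝ → ℝ := fun r => ∫ y in {y : EuclideanSpace ℝ (Fin 3) | r ≤ ‖y‖ ^ 2}, f y ^ (p / 3)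
    with hτf_def
  have hτU0 : ∀ r, 0 ≤ τU r := fun r => integral_nonneg fun y => by positivity
  have hτf0 : ∀ r, 0 ≤ τf r := fun r => integral_nonneg fun y => Real.rpow_nonneg (hf0 y) _
  set v₁ : ℝ := (volume : Measure (EuclideanSpace ℝ (Fin 3))).real
    (closedBall (0 : EuclideanSpace ℝ (Fin 3)) 1) with hv₁_def
  have hv₁ : 0 ≤ v₁ := measureReal_nonneg
  refine ⟨2 * (1 + α) * Cβ, by nlinarith, fun l hl => ?_⟩
  have ha : (0 : ℝ) < l ^ 2 := by positivity
  -- the weighted flux off the ball is integrable (Hölder, `(4 − 2α) p/(p−3) > 3`)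
  have hm : 3 < (4 - 2 * α) * (p / (p - 3)) := by
    have hp3 : 0 < p - 3 := by linarith
    rw [← mul_div_assoc, lt_div_iff₀ hp3]
    nlinarith
  have hWi : IntegrableOn (fun y : EuclideanSpace ℝ (Fin 3) => ‖y‖ ^ (-(4 - 2 * α)) * f y)
      (ball (0 : EuclideanSpace ℝ (Fin 3)) l)ᶜ volume :=
    (setIntegral_weight_mul_flux_le hp hm hl hf0 hfLp).1
  set W : ℝ := ∫ y in (ball (0 : EuclideanSpace ℝ (Fin 3)) l)ᶜ, ‖y‖ ^ (2 * α - 4) * f y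
    with hW_def
  have eβ1 : -(2 * β) - 1 = 2 * α - 4 := by rw [hβ_def]; ring
  have eβ2 : (2 : ℝ) * β = 3 - 2 * α := by rw [hβ_def]; ring
  have eβ3 : -(4 - 2 * α) = 2 * α - 4 := by ring
  -- constants for the outer terms
  set A₁ : ℝ := 4 * D * ((8 : ℝ) ^ β * l ^ (2 * β)) * v₁ ^ (1 - 2 / p) with hA₁_def
  set A₂ : ℝ := (1 + α) * (4 * D * ((8 : ℝ) ^ β * l ^ (2 * β))) * v₁ ^ (1 - 3 / p) with hA₂_def
  -- Step A: the two-scale estimate for every `l₂ ≥ max (2l) 1`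
  have hstep : ∀ l₂ : ℝ, max (2 * l) 1 ≤ l₂ →
      (3 - 2 * α) * ∫ y in ball (0 : EuclideanSpace ℝ (Fin 3)) l, ‖U y‖ ^ 2 ≤
        A₁ * (τU (l₂ ^ 2 / 2)) ^ (2 / p) + A₂ * (τf (l₂ ^ 2 / 2)) ^ (3 / p) +
          2 * (1 + α) * Cβ * l ^ (3 - 2 * α) * W := by
    intro l₂ hl₂
    have hl₂1 : 1 ≤ l₂ := le_trans (le_max_right _ _) hl₂
    have hl₂2 : 2 * l ≤ l₂ := le_trans (le_max_left _ _) hl₂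
    have hl₂0 : 0 < l₂ := by linarith
    have hb : (0 : ℝ) < l₂ ^ 2 := by positivity
    have hab : 4 * l ^ 2 ≤ l₂ ^ 2 := by nlinarith
    set θ : ℝ := (8 : ℝ) ^ β * l ^ (2 * β) * l₂ ^ (-(2 * β)) with hθ_def
    have hθ : 0 ≤ θ := by positivity
    -- the two cut-offs and the test function `Φ = Φ₁ Φ₂`
    obtain ⟨Φ₁, hΦ₁1, hΦ₁one, hΦ₁d0, hΦ₁nn, hΦ₁le, hΦ₁two, hΦ₁sign, hΦ₁dec⟩ :=
      exists_innerCut (β := β) hβ0 ha hD0 hD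
    obtain ⟨Φ₂, hΦ₂1, hΦ₂one, hΦ₂zero, hΦ₂nn, hΦ₂le, hΦ₂d0, hΦ₂dle, hΦ₂d_half, hΦ₂d_b⟩ :=
      exists_outerCut hb hD
    have hΦ1 : ContDiff ℝ 1 (fun t => Φ₁ t * Φ₂ t) := hΦ₁1.mul hΦ₂1
    have hΦT : ∀ t, l₂ ^ 2 ≤ t → (fun t => Φ₁ t * Φ₂ t) t = 0 := fun t ht => by
      simp only [hΦ₂zero t ht, mul_zero]
    have hΦd : ∀ t, deriv (fun t => Φ₁ t * Φ₂ t) t = deriv Φ₁ t * Φ₂ t + Φ₁ t * deriv Φ₂ t :=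
      fun t => ((((hΦ₁1.differentiable one_ne_zero) t).hasDerivAt).mul
        (((hΦ₂1.differentiable one_ne_zero) t).hasDerivAt)).deriv
    have hΦ₁sign' : ∀ t, (2 * α - 3) * Φ₁ t - 2 * t * deriv Φ₁ t ≤ 0 := fun t => by
      have := hΦ₁sign t
      rwa [show -(2 * β) = 2 * α - 3 by rw [hβ_def]; ring] at this
    have key := h.localEnergy_identity_radial hα0 hΦ1 hΦT
    beta_reduce at key
    -- pointwise bounds
    have hin : ∀ y : EuclideanSpace ℝ (Fin 3), l ≤ ‖y‖ →
        |deriv Φ₁ (‖y‖ ^ 2)| * ‖y‖ ≤ Cβ * l ^ (2 * β) * ‖y‖ ^ (-(2 * β) - 1) := by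
      intro y hy
      have := innerCut_radial_weight hβ0 hl hK₂ hΦ₁two hΦ₁dec hy
      rw [hCβ_def]
      linarith [this]
    have hout : ∀ y : EuclideanSpace ℝ (Fin 3), l₂ ^ 2 / 2 ≤ ‖y‖ ^ 2 → Φ₁ (‖y‖ ^ 2) ≤ θ :=
      fun y hy => innerCut_outer_bound hβ0 hl hl₂2 hΦ₁two hy
    have hP1 := twoScale_P1 (α := α) U rfl (by linarith : l ^ 2 ≤ l₂ ^ 2 / 2) hΦ₁one hΦ₁d0
      hΦ₁sign' hΦ₂one hΦ₂nn hΦd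
    have hP3 := weighted_P3 U hl₂0 rfl hD0 hθ hout hΦ₁nn hΦ₂d0 hΦ₂dle hΦ₂d_half hΦ₂d_b
    have hP2 := weighted_P2 (β := β) U P hl₂0 rfl hD0 hθ
      hΦ₁d0 hin hΦ₁nn hout hΦ₂nn hΦ₂le hΦ₂dle hΦ₂d_half hΦ₂d_b hΦd
    -- integrability of the pieces
    have hsuppL : ∀ {g : EuclideanSpace ℝ (Fin 3) → ℝ}, (∀ y, l₂ ^ 2 ≤ ‖y‖ ^ 2 → g y = 0) →
        HasCompactSupport g := by
      intro g hg
      refine HasCompactSupport.intro (isCompact_closedBall (0 : EuclideanSpace ℝ (Fin 3)) l₂)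
        fun y hy => hg y ?_
      rw [mem_closedBall_zero_iff, not_le] at hy
      exact pow_le_pow_left₀ hl₂0.le hy.le 2
    have hderiv_b : ∀ t, l₂ ^ 2 ≤ t → deriv (fun t => Φ₁ t * Φ₂ t) t = 0 := by
      intro t ht
      rw [hΦd t, hΦ₂d_b t ht, hΦ₂zero t ht]
      ring
    have hiL : Integrable (fun y : EuclideanSpace ℝ (Fin 3) =>
        ((2 * α - 3) * (Φ₁ (‖y‖ ^ 2) * Φ₂ (‖y‖ ^ 2)) -
          2 * ‖y‖ ^ 2 * deriv (fun t => Φ₁ t * Φ₂ t) (‖y‖ ^ 2)) * ‖U y‖ ^ 2) := by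
      have hc1 : Continuous fun y : EuclideanSpace ℝ (Fin 3) => Φ₁ (‖y‖ ^ 2) * Φ₂ (‖y‖ ^ 2) :=
        hΦ1.continuous.comp (continuous_norm.pow 2)
      have hc2 : Continuous fun y : EuclideanSpace ℝ (Fin 3) =>
          deriv (fun t => Φ₁ t * Φ₂ t) (‖y‖ ^ 2) :=
        hΦ1.continuous_deriv_one.comp (continuous_norm.pow 2)
      refine (((continuous_const.mul hc1).sub
        ((continuous_const.mul (continuous_norm.pow 2)).mul hc2)).mul (hUc.norm.pow 2))
        |>.integrable_of_hasCompactSupport (hsuppL fun y hy => ?_)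
      simp only [Pi.mul_apply, Pi.sub_apply, Pi.pow_apply]
      rw [hderiv_b _ hy, hΦ₂zero _ hy]
      ring
    have hiInd : Integrable (fun y => -(3 - 2 * α) *
        (ball (0 : EuclideanSpace ℝ (Fin 3)) l).indicator (fun y => ‖U y‖ ^ 2) y)
        (volume : Measure (EuclideanSpace ℝ (Fin 3))) := by
      refine Integrable.const_mul ?_ _
      exact (((hUc.norm.pow 2).continuousOn.integrableOn_compact
        (isCompact_closedBall (0 : EuclideanSpace ℝ (Fin 3)) l)).mono_set
        ball_subset_closedBall).integrable_indicator measurableSet_ball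
    have hiwt : Integrable (fun y : EuclideanSpace ℝ (Fin 3) =>
        2 * ‖y‖ ^ 2 * Φ₁ (‖y‖ ^ 2) * (-deriv Φ₂ (‖y‖ ^ 2)) * ‖U y‖ ^ 2) := by
      refine ((((continuous_const.mul (continuous_norm.pow 2)).mul
        (hΦ₁1.continuous.comp (continuous_norm.pow 2))).mul
        ((hΦ₂1.continuous_deriv_one.comp (continuous_norm.pow 2)).neg)).mul (hUc.norm.pow 2))
        |>.integrable_of_hasCompactSupport (hsuppL fun y hy => ?_)
      simp only [Pi.mul_apply, Pi.pow_apply, Pi.neg_apply, Function.comp_apply]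
      rw [hΦ₂d_b _ hy, neg_zero, mul_zero, zero_mul]
    set S : Set (EuclideanSpace ℝ (Fin 3)) :=
      {y : EuclideanSpace ℝ (Fin 3) | l₂ ^ 2 / 2 ≤ ‖y‖ ^ 2} ∩
        closedBall (0 : EuclideanSpace ℝ (Fin 3)) l₂ with hS_def
    have hSmeas : MeasurableSet S :=
      ((isClosed_le continuous_const (continuous_norm.pow 2)).measurableSet).inter
        measurableSet_closedBall
    have hSbdd : Bornology.IsBounded S := isBounded_closedBall.subset inter_subset_right
    have hSfin : volume S ≠ ⊤ := hSbdd.measure_lt_top.ne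
    have hiS : Integrable (fun y => 4 * D * θ * S.indicator (fun y => ‖U y‖ ^ 2) y)
        (volume : Measure (EuclideanSpace ℝ (Fin 3))) := by
      refine Integrable.const_mul ?_ _
      exact (((hUc.norm.pow 2).continuousOn.integrableOn_compact
        (isCompact_closedBall (0 : EuclideanSpace ℝ (Fin 3)) l₂)).mono_set
        inter_subset_right).integrable_indicator hSmeas
    have hfS : IntegrableOn f S volume := by
      haveI : IsFiniteMeasure (volume.restrict S) := isFiniteMeasure_restrict.2 hSfin
      exact (hfLp.restrict S).integrable (by
        rw [← ENNReal.ofReal_one]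
        exact ENNReal.ofReal_le_ofReal (by linarith))
    have hWi' : IntegrableOn (fun y : EuclideanSpace ℝ (Fin 3) => ‖y‖ ^ (-(2 * β) - 1) * f y)
        (ball (0 : EuclideanSpace ℝ (Fin 3)) l)ᶜ volume := by
      rw [eβ1, ← eβ3]
      exact hWi
    have hibound : Integrable (fun y : EuclideanSpace ℝ (Fin 3) =>
        2 * (Cβ * l ^ (2 * β)) * (ball (0 : EuclideanSpace ℝ (Fin 3)) l)ᶜ.indicator
            (fun y => ‖y‖ ^ (-(2 * β) - 1) * (‖U y‖ ^ 3 + 2 * (|P y| * ‖U y‖))) y +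
          4 * D * θ / l₂ * S.indicator (fun y => ‖U y‖ ^ 3 + 2 * (|P y| * ‖U y‖)) y) := by
      refine ((hWi'.integrable_indicator measurableSet_ball.compl).const_mul _).add ?_
      exact (hfS.integrable_indicator hSmeas).const_mul _
    -- integrate the pointwise bounds
    have hI1 : ∫ y : EuclideanSpace ℝ (Fin 3), ((2 * α - 3) * (Φ₁ (‖y‖ ^ 2) * Φ₂ (‖y‖ ^ 2)) -
          2 * ‖y‖ ^ 2 * deriv (fun t => Φ₁ t * Φ₂ t) (‖y‖ ^ 2)) * ‖U y‖ ^ 2 ≤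
        -(3 - 2 * α) * (∫ y in ball (0 : EuclideanSpace ℝ (Fin 3)) l, ‖U y‖ ^ 2) +
          ∫ y : EuclideanSpace ℝ (Fin 3),
            2 * ‖y‖ ^ 2 * Φ₁ (‖y‖ ^ 2) * (-deriv Φ₂ (‖y‖ ^ 2)) * ‖U y‖ ^ 2 := by
      rw [← integral_indicator measurableSet_ball, ← integral_const_mul,
        ← integral_add hiInd hiwt]
      exact integral_mono hiL (hiInd.add hiwt) hP1
    have hI3 : ∫ y : EuclideanSpace ℝ (Fin 3),
          2 * ‖y‖ ^ 2 * Φ₁ (‖y‖ ^ 2) * (-deriv Φ₂ (‖y‖ ^ 2)) * ‖U y‖ ^ 2 ≤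
        4 * D * θ * ∫ y in S, ‖U y‖ ^ 2 := by
      rw [← integral_indicator hSmeas, ← integral_const_mul]
      exact integral_mono hiwt hiS hP3
    have hup : ‖∫ y, (‖U y‖ ^ 2 + 2 * P y) *
          (2 * deriv (fun t => Φ₁ t * Φ₂ t) (‖y‖ ^ 2) * ⟪y, U y⟫)‖ ≤
        2 * (Cβ * l ^ (2 * β)) * (∫ y in (ball (0 : EuclideanSpace ℝ (Fin 3)) l)ᶜ,
            ‖y‖ ^ (-(2 * β) - 1) * f y) +
          4 * D * θ / l₂ * ∫ y in S, f y := by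
      rw [← integral_indicator hSmeas, ← integral_indicator measurableSet_ball.compl,
        ← integral_const_mul, ← integral_const_mul, ← integral_add]
      · exact norm_integral_le_of_norm_le hibound (Eventually.of_forall hP2)
      · exact (hWi'.integrable_indicator measurableSet_ball.compl).const_mul _
      · exact (hfS.integrable_indicator hSmeas).const_mul _
    -- Hölder on `S` and the tails
    have hvolS : (volume : Measure (EuclideanSpace ℝ (Fin 3))).real S ≤ v₁ * l₂ ^ 3 := by
      calc (volume : Measure (EuclideanSpace ℝ (Fin 3))).real S
          ≤ (volume : Measure (EuclideanSpace ℝ (Fin 3))).real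
              (closedBall (0 : EuclideanSpace ℝ (Fin 3)) l₂) :=
            measureReal_mono inter_subset_right measure_closedBall_lt_top.ne
        _ = v₁ * l₂ ^ 3 := by
            rw [hv₁_def, Measure.addHaar_real_closedBall' volume (0 : EuclideanSpace ℝ (Fin 3))
              hl₂0.le, finrank_euclideanSpace_fin, mul_comm]
    have hHU : ∫ y in S, ‖U y‖ ^ 2 ≤ (τU (l₂ ^ 2 / 2)) ^ (2 / p) * (v₁ * l₂ ^ 3) ^ (1 - 2 / p) := by
      have h1 := setIntegral_norm_sq_le_rpow_of_continuous (by linarith : (2 : ℝ) < p) hUc hSbdd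
      refine h1.trans ?_
      have hτS : ∫ y in S, ‖U y‖ ^ p ≤ τU (l₂ ^ 2 / 2) :=
        setIntegral_mono_set hUpi.integrableOn (ae_of_all _ fun y => by positivity)
          (ae_of_all _ fun y hy => hy.1)
      have h12 : 0 ≤ 1 - 2 / p := by
        rw [sub_nonneg, div_le_one hp0]
        linarith
      exact mul_le_mul (Real.rpow_le_rpow (integral_nonneg fun y => by positivity) hτS
        (by positivity)) (Real.rpow_le_rpow measureReal_nonneg hvolS h12)
        (Real.rpow_nonneg measureReal_nonneg _) (Real.rpow_nonneg (hτU0 _) _)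
    have hHf : ∫ y in S, f y ≤ (τf (l₂ ^ 2 / 2)) ^ (3 / p) * (v₁ * l₂ ^ 3) ^ (1 - 3 / p) := by
      have h1 := setIntegral_flux_le_rpow hp hf0 hfLp hSfin
      refine h1.trans ?_
      have hτS : ∫ y in S, f y ^ (p / 3) ≤ τf (l₂ ^ 2 / 2) :=
        setIntegral_mono_set hfi.integrableOn
          (ae_of_all _ fun y => Real.rpow_nonneg (hf0 y) _) (ae_of_all _ fun y hy => hy.1)
      have h13 : 0 ≤ 1 - 3 / p := by
        rw [sub_nonneg, div_le_one hp0]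
        linarith
      exact mul_le_mul (Real.rpow_le_rpow (integral_nonneg fun y => Real.rpow_nonneg (hf0 y) _)
        hτS (by positivity)) (Real.rpow_le_rpow measureReal_nonneg hvolS h13)
        (Real.rpow_nonneg measureReal_nonneg _) (Real.rpow_nonneg (hτf0 _) _)
    -- the outer coefficients are bounded independently of `l₂` (this is where `α ≤ 3/p` enters)
    have hsplit : ∀ e : ℝ, (v₁ * l₂ ^ 3) ^ e = v₁ ^ e * l₂ ^ (3 * e) := by
      intro e
      rw [Real.mul_rpow hv₁ (by positivity), ← Real.rpow_natCast, ← Real.rpow_mul hl₂0.le]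
      norm_num
    have hθ1 : θ * (v₁ * l₂ ^ 3) ^ (1 - 2 / p) ≤ (8 : ℝ) ^ β * l ^ (2 * β) * v₁ ^ (1 - 2 / p) := by
      rw [hsplit, hθ_def]
      have hexp : l₂ ^ (-(2 * β)) * l₂ ^ (3 * (1 - 2 / p)) ≤ 1 := by
        rw [← Real.rpow_add hl₂0]
        refine Real.rpow_le_one_of_one_le_of_nonpos hl₂1 ?_
        rw [hβ_def, show -(2 * (3 / 2 - α)) + 3 * (1 - 2 / p) = 2 * (α - 3 / p) by ring]
        linarith [hαp]
      have h8 : 0 ≤ (8 : ℝ) ^ β * l ^ (2 * β) * v₁ ^ (1 - 2 / p) := by positivity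
      calc (8 : ℝ) ^ β * l ^ (2 * β) * l₂ ^ (-(2 * β)) * (v₁ ^ (1 - 2 / p) * l₂ ^ (3 * (1 - 2 / p)))
          = (8 : ℝ) ^ β * l ^ (2 * β) * v₁ ^ (1 - 2 / p) *
              (l₂ ^ (-(2 * β)) * l₂ ^ (3 * (1 - 2 / p))) := by ring
        _ ≤ (8 : ℝ) ^ β * l ^ (2 * β) * v₁ ^ (1 - 2 / p) * 1 := by gcongr
        _ = (8 : ℝ) ^ β * l ^ (2 * β) * v₁ ^ (1 - 2 / p) := by ring
    have hθ2 : θ / l₂ * (v₁ * l₂ ^ 3) ^ (1 - 3 / p) ≤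
        (8 : ℝ) ^ β * l ^ (2 * β) * v₁ ^ (1 - 3 / p) := by
      rw [hsplit, hθ_def]
      have hexp : l₂ ^ (-(2 * β)) / l₂ * l₂ ^ (3 * (1 - 3 / p)) ≤ 1 := by
        rw [show l₂ ^ (-(2 * β)) / l₂ = l₂ ^ (-(2 * β) - 1) from
            (Real.rpow_sub_one hl₂0.ne' _).symm, ← Real.rpow_add hl₂0]
        refine Real.rpow_le_one_of_one_le_of_nonpos hl₂1 ?_
        rw [hβ_def, show -(2 * (3 / 2 - α)) - 1 + 3 * (1 - 3 / p) = 2 * (α - 3 / p) - 1 - 3 / p by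
          ring]
        have h3p : 0 < 3 / p := by positivity
        linarith [hαp]
      have h8 : 0 ≤ (8 : ℝ) ^ β * l ^ (2 * β) * v₁ ^ (1 - 3 / p) := by positivity
      calc (8 : ℝ) ^ β * l ^ (2 * β) * l₂ ^ (-(2 * β)) / l₂ *
            (v₁ ^ (1 - 3 / p) * l₂ ^ (3 * (1 - 3 / p)))
          = (8 : ℝ) ^ β * l ^ (2 * β) * v₁ ^ (1 - 3 / p) *
              (l₂ ^ (-(2 * β)) / l₂ * l₂ ^ (3 * (1 - 3 / p))) := by ring
        _ ≤ (8 : ℝ) ^ β * l ^ (2 * β) * v₁ ^ (1 - 3 / p) * 1 := by gcongr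
        _ = (8 : ℝ) ^ β * l ^ (2 * β) * v₁ ^ (1 - 3 / p) := by ring
    have hEout : 4 * D * θ * ∫ y in S, ‖U y‖ ^ 2 ≤ A₁ * (τU (l₂ ^ 2 / 2)) ^ (2 / p) := by
      calc 4 * D * θ * ∫ y in S, ‖U y‖ ^ 2
          ≤ 4 * D * θ * ((τU (l₂ ^ 2 / 2)) ^ (2 / p) * (v₁ * l₂ ^ 3) ^ (1 - 2 / p)) :=
            mul_le_mul_of_nonneg_left hHU (by positivity)
        _ = 4 * D * (θ * (v₁ * l₂ ^ 3) ^ (1 - 2 / p)) * (τU (l₂ ^ 2 / 2)) ^ (2 / p) := by ring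
        _ ≤ 4 * D * ((8 : ℝ) ^ β * l ^ (2 * β) * v₁ ^ (1 - 2 / p)) *
              (τU (l₂ ^ 2 / 2)) ^ (2 / p) := by
            gcongr
        _ = A₁ * (τU (l₂ ^ 2 / 2)) ^ (2 / p) := by rw [hA₁_def]; ring
    have hFout : (1 + α) * (4 * D * θ / l₂ * ∫ y in S, f y) ≤
        A₂ * (τf (l₂ ^ 2 / 2)) ^ (3 / p) := by
      have hα' : 0 ≤ 1 + α := by linarith
      calc (1 + α) * (4 * D * θ / l₂ * ∫ y in S, f y)
          ≤ (1 + α) * (4 * D * θ / l₂ *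
              ((τf (l₂ ^ 2 / 2)) ^ (3 / p) * (v₁ * l₂ ^ 3) ^ (1 - 3 / p))) := by
            refine mul_le_mul_of_nonneg_left (mul_le_mul_of_nonneg_left hHf ?_) hα'
            positivity
        _ = (1 + α) * (4 * D * (θ / l₂ * (v₁ * l₂ ^ 3) ^ (1 - 3 / p))) *
              (τf (l₂ ^ 2 / 2)) ^ (3 / p) := by ring
        _ ≤ (1 + α) * (4 * D * ((8 : ℝ) ^ β * l ^ (2 * β) * v₁ ^ (1 - 3 / p))) *
              (τf (l₂ ^ 2 / 2)) ^ (3 / p) := by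
            gcongr
        _ = A₂ * (τf (l₂ ^ 2 / 2)) ^ (3 / p) := by rw [hA₂_def]; ring
    -- combine
    have h1 := neg_le_abs (∫ y, (‖U y‖ ^ 2 + 2 * P y) *
      (2 * deriv (fun t => Φ₁ t * Φ₂ t) (‖y‖ ^ 2) * ⟪y, U y⟫))
    rw [← Real.norm_eq_abs] at h1
    have hα' : 0 ≤ 1 + α := by linarith
    have h2 : -((1 + α) * ∫ y, (‖U y‖ ^ 2 + 2 * P y) *
          (2 * deriv (fun t => Φ₁ t * Φ₂ t) (‖y‖ ^ 2) * ⟪y, U y⟫)) ≤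
        (1 + α) * (2 * (Cβ * l ^ (2 * β)) * (∫ y in (ball (0 : EuclideanSpace ℝ (Fin 3)) l)ᶜ,
            ‖y‖ ^ (-(2 * β) - 1) * f y) + 4 * D * θ / l₂ * ∫ y in S, f y) := by
      rw [← mul_neg]
      exact mul_le_mul_of_nonneg_left (h1.trans hup) hα'
    have hWeq : ∫ y in (ball (0 : EuclideanSpace ℝ (Fin 3)) l)ᶜ,
        ‖y‖ ^ (-(2 * β) - 1) * f y = W := by
      rw [hW_def, eβ1]
    rw [hWeq] at h2
    have hmain : (1 + α) * (2 * (Cβ * l ^ (2 * β)) * W) =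
        2 * (1 + α) * Cβ * l ^ (3 - 2 * α) * W := by
      rw [eβ2]
      ring
    linarith [hI1, key, hI3, hEout, hFout, h2, hmain]
  -- Step B: let `l₂ → ∞`
  have hτUlim : Tendsto (fun l₂ : ℝ => (τU (l₂ ^ 2 / 2)) ^ (2 / p)) atTop (𝓝 0) := by
    have h1 : Tendsto (fun l₂ : ℝ => l₂ ^ 2 / 2) atTop atTop :=
      (tendsto_pow_atTop two_ne_zero).atTop_div_const (by norm_num)
    have h2 : Tendsto τU atTop (𝓝 0) := tendsto_tail_setIntegral_norm_sq_le hUpi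
    have h3 := (h2.comp h1).rpow_const (p := (2 / p : ℝ)) (Or.inr (by positivity))
    rwa [Real.zero_rpow (by positivity)] at h3
  have hτflim : Tendsto (fun l₂ : ℝ => (τf (l₂ ^ 2 / 2)) ^ (3 / p)) atTop (𝓝 0) := by
    have h1 : Tendsto (fun l₂ : ℝ => l₂ ^ 2 / 2) atTop atTop :=
      (tendsto_pow_atTop two_ne_zero).atTop_div_const (by norm_num)
    have h2 : Tendsto τf atTop (𝓝 0) := tendsto_tail_setIntegral_norm_sq_le hfi
    have h3 := (h2.comp h1).rpow_const (p := (3 / p : ℝ)) (Or.inr (by positivity))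
    rwa [Real.zero_rpow (by positivity)] at h3
  have hlim : Tendsto (fun l₂ : ℝ => A₁ * (τU (l₂ ^ 2 / 2)) ^ (2 / p) +
      A₂ * (τf (l₂ ^ 2 / 2)) ^ (3 / p) + 2 * (1 + α) * Cβ * l ^ (3 - 2 * α) * W) atTop
      (𝓝 (A₁ * 0 + A₂ * 0 + 2 * (1 + α) * Cβ * l ^ (3 - 2 * α) * W)) :=
    ((hτUlim.const_mul A₁).add (hτflim.const_mul A₂)).add_const _
  rw [mul_zero, mul_zero, zero_add, zero_add] at hlim
  exact ge_of_tendsto hlim (by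
    filter_upwards [eventually_ge_atTop (max (2 * l) 1)] with l₂ hl₂
    exact hstep l₂ hl₂)

/-! ## The first growth bound `∫_{|y|<L} |U|² ≲ L^{2 − 9/p}` (CS13 (3.3)) and Theorem 3.2 for
`3 ≤ p < 9/2` -/

/-- **First growth bound, range `α ≤ 3/p`, general `p`** (CS13 (3.3): "`∫_{|y| ≤ L} |v|² dy ≤
L^{β_p}`, where `β_p = N − 1 − 3N/p`"). For `p > 3`, a stationary self-similar Euler profile
`(U, P)` with exponent `γ = 1/(α+1)`, `−1 < α ≤ 3/p`, `U ∈ C² ∩ L^p`, `P ∈ L^{p/2}`: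
`∫_{|y|<L} |U|² ≤ C L^{2 − 9/p}` for all `L > 0` — the weighted two-scale inequality
`ball_energy_le_weightedFlux` followed by Hölder's inequality for the weight
`|y|^{2α−4} ∈ L^{p/(p−3)}(|y| ≥ L)`. [cite: ChaeShvydkoy2013, §3.2.1 eq. (3.3)] -/
theorem IsSelfSimilarEulerProfile.energyGrowth_first_of_le {α p : ℝ}
    {U : EuclideanSpace ℝ (Fin 3) → EuclideanSpace ℝ (Fin 3)} {P : EuclideanSpace ℝ (Fin 3) → ℝ}
    (h : IsSelfSimilarEulerProfile (1 / (α + 1)) 0 U P) (hα : -1 < α) (hp : 3 < p)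
    (hαp : α ≤ 3 / p) (hU : MemLp U (ENNReal.ofReal p) volume)
    (hP : MemLp P (ENNReal.ofReal (p / 2)) volume) :
    ∃ C : ℝ, 0 ≤ C ∧ ∀ L : ℝ, 0 < L →
      ∫ y in ball (0 : EuclideanSpace ℝ (Fin 3)) L, ‖U y‖ ^ 2 ≤ C * L ^ (2 - 9 / p) := by
  have hp0 : 0 < p := by linarith
  have hp3 : 0 < p - 3 := by linarith
  have hαp' : α * p ≤ 3 := by
    have := mul_le_mul_of_nonneg_right hαp hp0.le
    rwa [div_mul_cancel₀ _ hp0.ne'] at this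
  have hα3 : 0 < 3 - 2 * α := by
    have : 3 / p < 1 := by rw [div_lt_one hp0]; linarith
    linarith
  obtain ⟨K, hK0, hK⟩ := h.ball_energy_le_weightedFlux hα hp hαp hU hP
  set f : EuclideanSpace ℝ (Fin 3) → ℝ := fun y => ‖U y‖ ^ 3 + 2 * (|P y| * ‖U y‖) with hf_def
  have hf0 : ∀ y, 0 ≤ f y := flux_nonneg U P
  have hfLp : MemLp f (ENNReal.ofReal (p / 3)) volume := memLp_flux_of_memLp hp hU hP
  set F : ℝ := (∫ y, f y ^ (p / 3)) ^ (3 / p) with hF_def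
  have hF0 : 0 ≤ F := Real.rpow_nonneg (integral_nonneg fun y => Real.rpow_nonneg (hf0 y) _) _
  set m : ℝ := 4 - 2 * α with hm_def
  set q : ℝ := p / (p - 3) with hq_def
  have hm : 3 < m * q := by
    rw [hm_def, hq_def, ← mul_div_assoc, lt_div_iff₀ hp3]
    nlinarith
  have hmq : 0 < m * q - 3 := sub_pos.2 hm
  set v : ℝ := (volume : Measure (EuclideanSpace ℝ (Fin 3))).real (ball 0 1) with hv_def
  have hv : 0 ≤ v := measureReal_nonneg
  set C₀ : ℝ := (3 * v / (m * q - 3)) ^ (1 - 3 / p) with hC₀_def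
  have hC₀ : 0 ≤ C₀ := Real.rpow_nonneg (by positivity) _
  have h13 : 0 ≤ 1 - 3 / p := by
    rw [sub_nonneg, div_le_one hp0]
    linarith
  refine ⟨K * C₀ * F / (3 - 2 * α), by positivity, fun L hL => ?_⟩
  -- the weighted tail by Hölder
  have hW := (setIntegral_weight_mul_flux_le hp hm hL hf0 hfLp).2
  have eW : ∫ y in (ball (0 : EuclideanSpace ℝ (Fin 3)) L)ᶜ, ‖y‖ ^ (2 * α - 4) * f y =
      ∫ y in (ball (0 : EuclideanSpace ℝ (Fin 3)) L)ᶜ, ‖y‖ ^ (-m) * f y := by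
    rw [hm_def, show -(4 - 2 * α) = 2 * α - 4 by ring]
  have hexp : (3 * v * (L ^ (3 - m * q) / (m * q - 3))) ^ (1 - 3 / p) =
      C₀ * L ^ (2 * α - 1 - 9 / p) := by
    rw [show 3 * v * (L ^ (3 - m * q) / (m * q - 3)) = (3 * v / (m * q - 3)) * L ^ (3 - m * q) by
      ring, Real.mul_rpow (by positivity) (Real.rpow_nonneg hL.le _), hC₀_def,
      ← Real.rpow_mul hL.le]
    congr 1
    rw [hm_def, hq_def]
    field_simp
    ring
  have hmain := hK L hL
  rw [eW] at hmain
  have hbound : (3 - 2 * α) * ∫ y in ball (0 : EuclideanSpace ℝ (Fin 3)) L, ‖U y‖ ^ 2 ≤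
      K * C₀ * F * L ^ (2 - 9 / p) := by
    calc (3 - 2 * α) * ∫ y in ball (0 : EuclideanSpace ℝ (Fin 3)) L, ‖U y‖ ^ 2
        ≤ K * L ^ (3 - 2 * α) * ∫ y in (ball (0 : EuclideanSpace ℝ (Fin 3)) L)ᶜ,
            ‖y‖ ^ (-m) * f y := hmain
      _ ≤ K * L ^ (3 - 2 * α) * ((3 * v * (L ^ (3 - m * q) / (m * q - 3))) ^ (1 - 3 / p) * F) :=
          mul_le_mul_of_nonneg_left hW (by positivity)
      _ = K * C₀ * F * (L ^ (3 - 2 * α) * L ^ (2 * α - 1 - 9 / p)) := by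
          rw [hexp]
          ring
      _ = K * C₀ * F * L ^ (2 - 9 / p) := by
          rw [← Real.rpow_add hL]
          ring_nf
  rw [div_mul_eq_mul_div, le_div_iff₀ hα3]
  linarith

/-- **Chae–Shvydkoy 2013, Theorem 3.2 for `3 < p < 9/2`, proved** (both ranges, no bootstrap:
`β_p = 2 − 9/p < 0`, CS13: "If `β_p < 0`, then the proof is finished by sending `L → ∞`"). A
stationary self-similar Euler profile `(U, P)` with exponent `γ = 1/(α+1)`, `U ∈ C² ∩ L^p(ℝ³)`,
`P ∈ L^{p/2}(ℝ³)`, `3 < p < 9/2`, and `−1 < α ≤ 3/p` or `α > 3/2`, is trivial. As at `p = 3`, the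
associated-pressure formula (2.3) is not needed below `p = 9/2` (it enters only through the
pressure-growth Lemma 3.3 of the bootstrap).
[cite: ChaeShvydkoy2013, §3.2 Thm. 3.2 (3 < p < 9/2)] -/
theorem IsSelfSimilarEulerProfile.eq_zero_of_memLp_of_lt_nine_halves {α p : ℝ}
    {U : EuclideanSpace ℝ (Fin 3) → EuclideanSpace ℝ (Fin 3)} {P : EuclideanSpace ℝ (Fin 3) → ℝ}
    (h : IsSelfSimilarEulerProfile (1 / (α + 1)) 0 U P) (hα : -1 < α) (hp : 3 < p)
    (hp9 : p < 9 / 2) (hrange : α ≤ 3 / p ∨ 3 / 2 < α) (hU : MemLp U (ENNReal.ofReal p) volume)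
    (hP : MemLp P (ENNReal.ofReal (p / 2)) volume) : U = 0 := by
  have hp0 : 0 < p := by linarith
  have hUc : Continuous U := h.contDiff_velocity.continuous
  -- the first growth bound with exponent `2 − 9/p < 0`, in either range
  obtain ⟨C, -, hC⟩ : ∃ C : ℝ, 0 ≤ C ∧ ∀ L : ℝ, 0 < L →
      ∫ y in ball (0 : EuclideanSpace ℝ (Fin 3)) L, ‖U y‖ ^ 2 ≤ C * L ^ (2 - 9 / p) := by
    rcases hrange with h1 | h2
    · exact h.energyGrowth_first_of_le hα hp h1 hU hP
    · exact h.energyGrowth_first_of_gt_three_halves h2 hp hU hP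
  -- `2 − 9/p = 3 − 2a` with `a = (1 + 9/p)/2 > 3/2` iff `p < 9/2`
  have ha : (3 : ℝ) / 2 < (1 + 9 / p) / 2 := by
    have : (2 : ℝ) < 9 / p := by
      rw [lt_div_iff₀ hp0]
      linarith
    linarith
  refine eq_zero_of_energyGrowth_of_three_halves_lt (α := (1 + 9 / p) / 2) (C := C) (L₀ := 1)
    ha hUc fun L hL => ?_
  rw [show (3 : ℝ) - 2 * ((1 + 9 / p) / 2) = 2 - 9 / p by ring]
  exact hC L (by linarith)

/-- **The named fact `chaeShvydkoy2013_Lp_exclusion` restricted to `p < 9/2` is a theorem** (its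
body verbatim with the extra hypothesis `p.toReal < 9/2`; the weak-Poisson hypothesis is unused in
this range). [cite: ChaeShvydkoy2013, §3.2 Thm. 3.2 (3 ≤ p < 9/2)] -/
theorem chaeShvydkoy2013_Lp_exclusion_of_lt_nine_halves (α : ℝ) (p : ℝ≥0∞)
    (U : EuclideanSpace ℝ (Fin 3) → EuclideanSpace ℝ (Fin 3)) (P : EuclideanSpace ℝ (Fin 3) → ℝ)
    (hα : -1 < α) (h3 : 3 ≤ p) (htop : p ≠ ∞) (hp9 : p.toReal < 9 / 2)
    (hrange : α ≤ 3 / p.toReal ∨ 3 / 2 < α)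
    (hprof : IsSelfSimilarEulerProfile (1 / (α + 1)) 0 U P)
    (hU : MemLp U p volume) (hP : MemLp P (p / 2) volume)
    (_hPoisson : ∀ φ : EuclideanSpace ℝ (Fin 3) → ℝ, ContDiff ℝ (⊤ : ℕ∞) φ → HasCompactSupport φ →
      ∫ x, P x * (Δ φ) x = -∫ x, fderiv ℝ (fderiv ℝ φ) x (U x) (U x)) :
    U = 0 := by
  rcases eq_or_lt_of_le h3 with h3eq | h3lt
  · -- `p = 3`: the tree's `p = 3` theorem
    subst h3eq
    refine chaeShvydkoy2013_L3_exclusion α U P hα ?_ hprof hU hP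
    have e : (3 : ℝ) / (3 : ℝ≥0∞).toReal = 1 := by norm_num
    rwa [e] at hrange
  · -- `3 < p < 9/2`
    have hpr : 3 < p.toReal := by
      have := (ENNReal.toReal_lt_toReal (by norm_num : (3 : ℝ≥0∞) ≠ ⊤) htop).2 h3lt
      simpa using this
    have hp0 : 0 < p.toReal := by linarith
    have hU' : MemLp U (ENNReal.ofReal p.toReal) volume := by rwa [ENNReal.ofReal_toReal htop]
    have hP' : MemLp P (ENNReal.ofReal (p.toReal / 2)) volume := by
      rw [ENNReal.ofReal_div_of_pos two_pos, ENNReal.ofReal_toReal htop]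
      simpa using hP
    exact hprof.eq_zero_of_memLp_of_lt_nine_halves hα hpr hp9 hrange hU' hP'

end Literature.Analysis.FluidPDE
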